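import Literature.NumberTheory.Automorphic.EichlerEmbeddingLocalSplit
import HarnessLib

/-!
# Local optimal embedding numbers at a prime dividing the level: `m_q(B) = ρ_q(B) + [B_q not maximal]`
# (Eichler orders of level `q`; Vignéras LNM 800 Ch. II §3, Eichler 1955 Satz 8, Hijikata 1974)

Topic `NumberTheory/Automorphic`; definitions with bodies and theorems (no named fact, no
`sorry`). Fourth brick of the Brandt-module side of the Eichler–Pizer trace identity: the local
embedding numbers `m_q = localEmbeddingNumber O γ B q` of `EichlerEmbeddingLocalGlobal.lean` at a
prime `q` at which the Eichler order `O` has a **level-`q` matrix model**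
`O_(q) = Φ⁻¹(ℤ_q ℤ_q; q ℤ_q ℤ_q)` (all `q ∥ N⁺`, by `IsEichlerOrder.exists_conjUnit_localAt_iff_eichler`).

For an order `B ∋ γ` of `ℚ(γ)` with `ℤ`-basis `(1, σ₀)` and `σ₀² = t_B σ₀ - n_B`:

  `m_q(B) = #{k mod q : q ∣ k² + t_B k + n_B} + [∃ k, q ∣ t_B + 2k ∧ q² ∣ k² + t_B k + n_B]`,

i.e. `1 + (K/q)` if `B` is maximal at `q` and `2` otherwise (Eichler's `1 + {B/q}` with his
symbol `{B/q} = 1` for `q ∣ f(B)`), in the explicit integer form consumed by the resummation.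

## The count (lattice pairs; Vignéras II §3, Hijikata §2)

`O_q = End(ℤ_q²) ∩ End(Λ₁⁰)`, `Λ₁⁰ = ℤ_q ⊕ q ℤ_q`, so a local ideal `x O_(q)` is the pair of
lattices `(Λ_x, Λ'_x) = (Φ(x) ℤ_q², Φ(x) Λ₁⁰)` (`mem_smul_localAt_iff_level`) and its optimal order is
the set of rational points of `mult(L) ∩ mult(L')` for the transported pair `(L, L') = (ι⁻¹ Λ_x,
ι⁻¹ Λ'_x) = ([α, β], [α, qβ])` of lattices of `K_q` (`ratCoords_mem_optimalOrder_smul_iff_level`).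
Classes modulo `ℚ(γ)ˣ` are classes of pairs modulo `K_qˣ` (density, `exists_eq_smul_of_pair_eq`,
`exists_units_pair_eq`). Normalising `L = R = [1, σ]` (its multiplier ring), `L'` is one of the `q + 1`
lattices `[1, qσ]`, `[σ + k, q]` (`k mod q`) between `qR` and `R` (`latt_smul_eq_cases`), with
`R ∩ mult L' = R` iff `L'` is an `R`-ideal iff `q ∣ N(σ + k)` (`ρ_q(R)` values of `k`), and
`R ∩ mult L' = ℤ_q + qR` otherwise, the latter lattices forming one `Rˣ`-orbit
(`image_mul_latt_one_smul`). Hence the classes with optimal order `B_q`: `ρ_q(B)` of the first kind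
and one of the second kind for the unique ring `R' ⊋ B_q` with `ℤ_q + qR' = B_q`, if `B_q` is not
maximal (`latt_one_eq_of_latt_one_smul_eq`).

## References

* M.-F. Vignéras, *Arithmétique des algèbres de quaternions*, LNM 800 (1980), Ch. II §3
  (plongements maximaux dans les ordres d'Eichler), Ch. III §5 Cor. 5.12 [VignerasLNM800].
* M. Eichler, *Zur Zahlentheorie der Quaternionen-Algebren*, J. reine angew. Math. 195 (1955), §2
  (the symbol `{𝔬/p}`) and Satz 8 [Eichler1955].
* H. Hijikata, *Explicit formula of the traces of Hecke operators for `Γ₀(N)`*, J. Math. Soc.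
  Japan 26 (1974), §2 (the numbers `c(s, f; N)` at `ord_q N = 1`) [Hijikata1974].
-/

noncomputable section

open scoped Pointwise Matrix

universe u

namespace Literature.NumberTheory.Automorphic

namespace Brandt

open Literature.NumberTheory.QuadraticFields.PadicQuadratic
open scoped QuadraticAlgebra

/-! ### Lattice pairs `([α, β], [α, qβ])` in a quadratic `ℚ_q`-algebra -/

section Pairs

variable {q : ℕ} [hq : Fact q.Prime] {a b : ℚ_[q]}

/-- `‖q‖ = q⁻¹ < 1` bookkeeping: `‖q‖ ≤ 1`. [folklore] -/
theorem norm_q_le_one : ‖(q : ℚ_[q])‖ ≤ 1 := by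
  rw [Padic.norm_p]; exact inv_le_one_of_one_le₀ (by exact_mod_cast hq.out.one_lt.le)

/-- `‖x‖ < 1 ↔ ‖x‖ ≤ q⁻¹` in `ℚ_q`. [folklore] -/
theorem norm_lt_one_iff_le_inv (x : ℚ_[q]) : ‖x‖ < 1 ↔ ‖x‖ ≤ (q : ℝ)⁻¹ := by
  have h := Padic.norm_le_pow_iff_norm_lt_pow_add_one x (-1)
  simp only [Int.reduceNeg, neg_add_cancel, zpow_zero, zpow_neg, zpow_one] at h
  exact h.symm

/-- `‖x‖ < 1 ↔ x = q y` with `‖y‖ ≤ 1`. [folklore] -/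
theorem norm_lt_one_iff_exists (x : ℚ_[q]) : ‖x‖ < 1 ↔ ∃ y : ℚ_[q], ‖y‖ ≤ 1 ∧ x = (q : ℚ_[q]) * y := by
  have hq0 : (q : ℚ_[q]) ≠ 0 := Nat.cast_ne_zero.mpr hq.out.ne_zero
  have hqr : (0 : ℝ) < q := by exact_mod_cast hq.out.pos
  rw [norm_lt_one_iff_le_inv]
  constructor
  · intro h
    refine ⟨(q : ℚ_[q])⁻¹ * x, ?_, by rw [mul_inv_cancel_left₀ hq0]⟩
    rw [norm_mul, norm_inv, Padic.norm_p, inv_inv]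
    calc (q : ℝ) * ‖x‖ ≤ q * (q : ℝ)⁻¹ := by gcongr
      _ = 1 := mul_inv_cancel₀ hqr.ne'
  · rintro ⟨y, hy, rfl⟩
    rw [norm_mul, Padic.norm_p]
    calc (q : ℝ)⁻¹ * ‖y‖ ≤ (q : ℝ)⁻¹ * 1 := by gcongr
      _ = (q : ℝ)⁻¹ := mul_one _

/-- **Unimodular change of basis**: if `(α', β') = M (α, β)` with `M ∈ GL₂(ℤ_q)` then
`[α', β'] = [α, β]`. [folklore] -/
theorem latt_eq_of_unimodular {α β α' β' : QuadraticAlgebra ℚ_[q] a b} {m₀₀ m₀₁ m₁₀ m₁₁ : ℚ_[q]}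
    (h₀₀ : ‖m₀₀‖ ≤ 1) (h₀₁ : ‖m₀₁‖ ≤ 1) (h₁₀ : ‖m₁₀‖ ≤ 1) (h₁₁ : ‖m₁₁‖ ≤ 1)
    (hdet : ‖m₀₀ * m₁₁ - m₀₁ * m₁₀‖ = 1) (hα' : α' = m₀₀ • α + m₀₁ • β)
    (hβ' : β' = m₁₀ • α + m₁₁ • β) : latt α' β' = latt α β := by
  set d := m₀₀ * m₁₁ - m₀₁ * m₁₀ with hd
  have hd0 : d ≠ 0 := fun h => by rw [h, norm_zero] at hdet; exact zero_ne_one hdet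
  have hdi : ‖d⁻¹‖ = 1 := by rw [norm_inv, hdet, inv_one]
  refine Set.Subset.antisymm (latt_subset_of_mem ?_ ?_) (latt_subset_of_mem ?_ ?_)
  · rw [hα']; exact add_mem_latt (smul_mem_latt h₀₀ (left_mem_latt α β)) (smul_mem_latt h₀₁ (right_mem_latt α β))
  · rw [hβ']; exact add_mem_latt (smul_mem_latt h₁₀ (left_mem_latt α β)) (smul_mem_latt h₁₁ (right_mem_latt α β))
  · have e : α = (d⁻¹ * m₁₁) • α' + (-(d⁻¹ * m₀₁)) • β' := by
      rw [hα', hβ', smul_add, smul_add, smul_smul, smul_smul, smul_smul, smul_smul]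
      have : (1 : ℚ_[q]) = d⁻¹ * m₁₁ * m₀₀ + -(d⁻¹ * m₀₁) * m₁₀ := by
        field_simp; rw [hd]; ring
      calc α = (1 : ℚ_[q]) • α + (0 : ℚ_[q]) • β := by rw [one_smul, zero_smul, add_zero]
        _ = _ := by rw [this, show (0 : ℚ_[q]) = d⁻¹ * m₁₁ * m₀₁ + -(d⁻¹ * m₀₁) * m₁₁ by ring]; module
    rw [e]
    refine add_mem_latt (smul_mem_latt ?_ (left_mem_latt _ _)) (smul_mem_latt ?_ (right_mem_latt _ _))
    · rw [norm_mul, hdi, one_mul]; exact h₁₁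
    · rw [norm_neg, norm_mul, hdi, one_mul]; exact h₀₁
  · have e : β = (-(d⁻¹ * m₁₀)) • α' + (d⁻¹ * m₀₀) • β' := by
      rw [hα', hβ', smul_add, smul_add, smul_smul, smul_smul, smul_smul, smul_smul]
      have : (1 : ℚ_[q]) = -(d⁻¹ * m₁₀) * m₀₁ + d⁻¹ * m₀₀ * m₁₁ := by
        field_simp; rw [hd]; ring
      calc β = (0 : ℚ_[q]) • α + (1 : ℚ_[q]) • β := by rw [one_smul, zero_smul, zero_add]
        _ = _ := by rw [this, show (0 : ℚ_[q]) = -(d⁻¹ * m₁₀) * m₀₀ + d⁻¹ * m₀₀ * m₁₀ by ring]; module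
    rw [e]
    refine add_mem_latt (smul_mem_latt ?_ (left_mem_latt _ _)) (smul_mem_latt ?_ (right_mem_latt _ _))
    · rw [norm_neg, norm_mul, hdi, one_mul]; exact h₁₀
    · rw [norm_mul, hdi, one_mul]; exact h₀₀

/-- **Coordinates on a ring lattice are unique**: `u + vσ = u' + v'σ` forces `u = u'`, `v = v'`
(`σ ∉ ℚ_q`). [folklore] -/
theorem smul_one_add_smul_inj {σ : QuadraticAlgebra ℚ_[q] a b} (hσ : σ.im ≠ 0) {u v u' v' : ℚ_[q]}
    (h : u • (1 : QuadraticAlgebra ℚ_[q] a b) + v • σ = u' • 1 + v' • σ) : u = u' ∧ v = v' := by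
  have hre := congrArg QuadraticAlgebra.re h
  have him := congrArg QuadraticAlgebra.im h
  simp only [QuadraticAlgebra.re_add, QuadraticAlgebra.re_smul, QuadraticAlgebra.im_add,
    QuadraticAlgebra.im_smul, smul_eq_mul, QuadraticAlgebra.re_one, QuadraticAlgebra.im_one,
    mul_one, mul_zero, zero_add] at hre him
  have hv : v = v' := mul_right_cancel₀ hσ him
  refine ⟨?_, hv⟩
  rw [hv] at hre
  linear_combination hre

/-- Membership in `[1, σ]`, coordinate form (definitional). [folklore] -/
theorem mem_latt_one_iff {σ : QuadraticAlgebra ℚ_[q] a b} {z : QuadraticAlgebra ℚ_[q] a b} :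
    z ∈ latt 1 σ ↔ ∃ u v : ℚ_[q], ‖u‖ ≤ 1 ∧ ‖v‖ ≤ 1 ∧ z = u • 1 + v • σ := Iff.rfl

/-- `[1, σ + k] = [1, σ]` for integral `k`. [folklore] -/
theorem latt_one_add_smul_one (σ : QuadraticAlgebra ℚ_[q] a b) {k : ℚ_[q]} (hk : ‖k‖ ≤ 1) :
    latt 1 (σ + k • 1) = latt 1 σ :=
  latt_eq_of_unimodular (m₀₀ := 1) (m₀₁ := 0) (m₁₀ := k) (m₁₁ := 1) (by simp) (by simp) hk (by simp)
    (by simp) (by rw [one_smul, zero_smul, add_zero]) (by rw [one_smul, add_comm])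

/-- **The `q + 1` lattices between `qR` and `R`.** If `[α, β] = [1, σ]` (`σ ∉ ℚ_q`) then `[α, qβ]` is
either `[1, qσ]` or `[σ + k, q]` for some `k ∈ ℤ_q` (according as the line of `α` in `R/qR` is that
of `1` or not). [cite: VignerasLNM800, Ch. II §2 Lemme 2.2 (diviseurs élémentaires)] -/
theorem latt_smul_eq_cases {σ α β : QuadraticAlgebra ℚ_[q] a b} (hσ : σ.im ≠ 0)
    (h : latt α β = latt 1 σ) :
    latt α ((q : ℚ_[q]) • β) = latt 1 ((q : ℚ_[q]) • σ) ∨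
      ∃ k : ℚ_[q], ‖k‖ ≤ 1 ∧ latt α ((q : ℚ_[q]) • β) = latt (σ + k • 1) ((q : ℚ_[q]) • 1) := by
  have hq0 : (q : ℚ_[q]) ≠ 0 := Nat.cast_ne_zero.mpr hq.out.ne_zero
  have hq1 := norm_q_le_one (q := q)
  -- coordinates of `α, β` on `(1, σ)` and of `1, σ` on `(α, β)`
  obtain ⟨a₁, b₁, ha₁, hb₁, hα⟩ : α ∈ latt 1 σ := h ▸ left_mem_latt α β
  obtain ⟨c₁, d₁, hc₁, hd₁, hβ⟩ : β ∈ latt 1 σ := h ▸ right_mem_latt α β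
  obtain ⟨u₁, v₁, hu₁, hv₁, h1⟩ : (1 : QuadraticAlgebra ℚ_[q] a b) ∈ latt α β := h ▸ left_mem_latt 1 σ
  obtain ⟨u₂, v₂, hu₂, hv₂, h2⟩ : σ ∈ latt α β := h ▸ right_mem_latt 1 σ
  -- the change of basis is unimodular: `(u₁ v₁; u₂ v₂)(a₁ b₁; c₁ d₁) = 1`
  have e1 : (1 : QuadraticAlgebra ℚ_[q] a b) = (u₁ * a₁ + v₁ * c₁) • 1 + (u₁ * b₁ + v₁ * d₁) • σ := by
    conv_lhs => rw [h1, hα, hβ]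
    module
  have e2 : σ = (u₂ * a₁ + v₂ * c₁) • 1 + (u₂ * b₁ + v₂ * d₁) • σ := by
    conv_lhs => rw [h2, hα, hβ]
    module
  have h11 := smul_one_add_smul_inj hσ (show (1 : ℚ_[q]) • (1 : QuadraticAlgebra ℚ_[q] a b) + (0 : ℚ_[q]) • σ =
    (u₁ * a₁ + v₁ * c₁) • 1 + (u₁ * b₁ + v₁ * d₁) • σ by rw [one_smul, zero_smul, add_zero]; exact e1)
  have h22 := smul_one_add_smul_inj hσ (show (0 : ℚ_[q]) • (1 : QuadraticAlgebra ℚ_[q] a b) + (1 : ℚ_[q]) • σ =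
    (u₂ * a₁ + v₂ * c₁) • 1 + (u₂ * b₁ + v₂ * d₁) • σ by rw [one_smul, zero_smul, zero_add]; exact e2)
  have hdet1 : (u₁ * v₂ - v₁ * u₂) * (a₁ * d₁ - b₁ * c₁) = 1 := by
    linear_combination (-(u₂ * b₁ + v₂ * d₁)) * h11.1 - h22.2 + (u₂ * a₁ + v₂ * c₁) * h11.2
  have hsub : ∀ x y : ℚ_[q], ‖x - y‖ ≤ max ‖x‖ ‖y‖ := fun x y => by
    rw [sub_eq_add_neg, ← norm_neg y]; exact Padic.nonarchimedean x (-y)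
  have hdetU : ‖u₁ * v₂ - v₁ * u₂‖ ≤ 1 := (hsub _ _).trans (max_le
    (by rw [norm_mul]; exact mul_le_one₀ hu₁ (norm_nonneg _) hv₂)
    (by rw [norm_mul]; exact mul_le_one₀ hv₁ (norm_nonneg _) hu₂))
  have hdetA' : ‖a₁ * d₁ - b₁ * c₁‖ ≤ 1 := (hsub _ _).trans (max_le
    (by rw [norm_mul]; exact mul_le_one₀ ha₁ (norm_nonneg _) hd₁)
    (by rw [norm_mul]; exact mul_le_one₀ hb₁ (norm_nonneg _) hc₁))
  have hdetA : ‖a₁ * d₁ - b₁ * c₁‖ = 1 := by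
    have h1 : ‖u₁ * v₂ - v₁ * u₂‖ * ‖a₁ * d₁ - b₁ * c₁‖ = 1 := by rw [← norm_mul, hdet1, norm_one]
    by_contra hne
    have hlt : ‖a₁ * d₁ - b₁ * c₁‖ < 1 := lt_of_le_of_ne hdetA' hne
    have : ‖u₁ * v₂ - v₁ * u₂‖ * ‖a₁ * d₁ - b₁ * c₁‖ < 1 :=
      mul_lt_one_of_nonneg_of_lt_one_right hdetU (norm_nonneg _) hlt
    rw [h1] at this
    exact lt_irrefl _ this
  rcases hb₁.lt_or_eq with hb | hb
  · -- `‖b₁‖ < 1`: the line of `α` is that of `1`, and `[α, qβ] = [1, qσ]`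
    left
    obtain ⟨b₂, hb₂, hb₁₂⟩ := (norm_lt_one_iff_exists b₁).mp hb
    refine latt_eq_of_unimodular (m₀₀ := a₁) (m₀₁ := b₂) (m₁₀ := (q : ℚ_[q]) * c₁) (m₁₁ := d₁)
      ha₁ hb₂ (by rw [norm_mul]; exact mul_le_one₀ hq1 (norm_nonneg _) hc₁) hd₁ ?_ ?_ ?_
    · rw [show a₁ * d₁ - b₂ * ((q : ℚ_[q]) * c₁) = a₁ * d₁ - b₁ * c₁ by rw [hb₁₂]; ring]
      exact hdetA
    · rw [hα, hb₁₂, smul_smul, mul_comm]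
    · rw [hβ, smul_add, smul_smul, smul_smul, smul_smul, mul_comm d₁]
  · -- `‖b₁‖ = 1`: the line of `α` is that of `σ + a₁/b₁`
    right
    have hb0 : b₁ ≠ 0 := fun h0 => by rw [h0, norm_zero] at hb; exact zero_ne_one hb
    refine ⟨a₁ / b₁, by rw [norm_div, hb, div_one]; exact ha₁, ?_⟩
    refine latt_eq_of_unimodular (m₀₀ := b₁) (m₀₁ := 0) (m₁₀ := (q : ℚ_[q]) * d₁)
      (m₁₁ := c₁ - d₁ * (a₁ / b₁)) hb₁ (by simp)
      (by rw [norm_mul]; exact mul_le_one₀ hq1 (norm_nonneg _) hd₁) ?_ ?_ ?_ ?_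
    · refine (hsub _ _).trans (max_le hc₁ ?_)
      rw [norm_mul, norm_div, hb, div_one]; exact mul_le_one₀ hd₁ (norm_nonneg _) ha₁
    · rw [show b₁ * (c₁ - d₁ * (a₁ / b₁)) - 0 * ((q : ℚ_[q]) * d₁) = -(a₁ * d₁ - b₁ * c₁) by
        field_simp; ring, norm_neg]
      exact hdetA
    · rw [hα, zero_smul, add_zero, smul_add, smul_smul, mul_div_cancel₀ _ hb0, add_comm]
    · rw [hβ, smul_add, smul_add, smul_smul, smul_smul, smul_smul]
      have e : (q : ℚ_[q]) * d₁ * (a₁ / b₁) + (c₁ - d₁ * (a₁ / b₁)) * (q : ℚ_[q]) = (q : ℚ_[q]) * c₁ := by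
        ring
      calc ((q : ℚ_[q]) * c₁) • (1 : QuadraticAlgebra ℚ_[q] a b) + ((q : ℚ_[q]) * d₁) • σ
          = ((q : ℚ_[q]) * d₁ * (a₁ / b₁) + (c₁ - d₁ * (a₁ / b₁)) * (q : ℚ_[q])) • 1 +
              ((q : ℚ_[q]) * d₁) • σ := by rw [e]
        _ = _ := by module

/-! ### Ring generators `σ + k`, closure properties of multiplier rings -/

/-- `tr(σ + k) = tr σ + 2k`. [folklore] -/
theorem tr_add_smul_one (σ : QuadraticAlgebra ℚ_[q] a b) (k : ℚ_[q]) :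
    tr (σ + k • 1) = tr σ + 2 * k := by
  simp [tr, QuadraticAlgebra.re_one, QuadraticAlgebra.im_one]; ring

/-- `N(σ + k) = N(σ) + k tr σ + k²`. [folklore] -/
theorem norm_add_smul_one (σ : QuadraticAlgebra ℚ_[q] a b) (k : ℚ_[q]) :
    (σ + k • 1).norm = σ.norm + k * tr σ + k ^ 2 := by
  simp [tr, QuadraticAlgebra.norm_def, QuadraticAlgebra.re_one, QuadraticAlgebra.im_one]; ring

/-- `N(y + cσ) = y² + y c tr σ + c² N(σ)`. [folklore] -/
theorem norm_smul_one_add_smul (σ : QuadraticAlgebra ℚ_[q] a b) (y c : ℚ_[q]) :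
    (y • (1 : QuadraticAlgebra ℚ_[q] a b) + c • σ).norm = y ^ 2 + y * c * tr σ + c ^ 2 * σ.norm := by
  simp [tr, QuadraticAlgebra.norm_def, QuadraticAlgebra.re_one, QuadraticAlgebra.im_one]; ring

/-- `(σ + k).im = σ.im`. [folklore] -/
theorem im_add_smul_one (σ : QuadraticAlgebra ℚ_[q] a b) (k : ℚ_[q]) : (σ + k • 1).im = σ.im := by
  simp [QuadraticAlgebra.im_one]

/-- `(cσ).im = c σ.im`. [folklore] -/
theorem im_smul' (σ : QuadraticAlgebra ℚ_[q] a b) (c : ℚ_[q]) : (c • σ).im = c * σ.im := by simp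

/-- `‖2‖ ≤ 1` in `ℚ_q`. [folklore] -/
theorem norm_two_le_one : ‖(2 : ℚ_[q])‖ ≤ 1 := by simpa using Padic.norm_int_le_one (p := q) 2

/-- Ultrametric inequality for differences. [folklore] -/
theorem norm_sub_le_max (x y : ℚ_[q]) : ‖x - y‖ ≤ max ‖x‖ ‖y‖ := by
  rw [sub_eq_add_neg, ← norm_neg y]; exact Padic.nonarchimedean x (-y)

/-- **`σ + k` is again a ring generator** (`k ∈ ℤ_q`). [folklore] -/
theorem ring_add_smul_one {σ : QuadraticAlgebra ℚ_[q] a b} (hσ : σ.im ≠ 0) (hring : σ * σ ∈ latt 1 σ)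
    {k : ℚ_[q]} (hk : ‖k‖ ≤ 1) : (σ + k • 1) * (σ + k • 1) ∈ latt 1 (σ + k • 1) := by
  obtain ⟨ht, hN⟩ := (mul_self_mem_latt_one_iff hσ).mp hring
  rw [mul_self_mem_latt_one_iff (by rw [im_add_smul_one]; exact hσ), tr_add_smul_one, norm_add_smul_one]
  constructor
  · refine (Padic.nonarchimedean _ _).trans (max_le ht ?_)
    rw [norm_mul]; exact mul_le_one₀ norm_two_le_one (norm_nonneg _) hk
  · refine (Padic.nonarchimedean _ _).trans (max_le ((Padic.nonarchimedean _ _).trans (max_le hN ?_)) ?_)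
    · rw [norm_mul]; exact mul_le_one₀ hk (norm_nonneg _) ht
    · rw [norm_pow]; exact pow_le_one₀ (norm_nonneg _) hk

/-- **`qσ` is a ring generator** when `σ` is. [folklore] -/
theorem ring_smul {σ : QuadraticAlgebra ℚ_[q] a b} (hσ : σ.im ≠ 0) (hring : σ * σ ∈ latt 1 σ) :
    ((q : ℚ_[q]) • σ) * ((q : ℚ_[q]) • σ) ∈ latt 1 ((q : ℚ_[q]) • σ) := by
  have hq0 : (q : ℚ_[q]) ≠ 0 := Nat.cast_ne_zero.mpr hq.out.ne_zero
  obtain ⟨ht, hN⟩ := (mul_self_mem_latt_one_iff hσ).mp hring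
  rw [mul_self_mem_latt_one_iff (by rw [im_smul']; exact mul_ne_zero hq0 hσ)]
  have htq : tr ((q : ℚ_[q]) • σ) = (q : ℚ_[q]) * tr σ := by simp [tr]; ring
  have hNq : ((q : ℚ_[q]) • σ).norm = (q : ℚ_[q]) ^ 2 * σ.norm := by
    simp [QuadraticAlgebra.norm_def]; ring
  rw [htq, hNq, norm_mul, norm_mul, norm_pow]
  exact ⟨mul_le_one₀ norm_q_le_one (norm_nonneg _) ht,
    mul_le_one₀ (pow_le_one₀ (norm_nonneg _) norm_q_le_one) (norm_nonneg _) hN⟩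

/-- `[1, qσ] ⊆ [1, σ]`. [folklore] -/
theorem latt_one_smul_subset (σ : QuadraticAlgebra ℚ_[q] a b) :
    latt 1 ((q : ℚ_[q]) • σ) ⊆ latt 1 σ :=
  latt_subset_of_mem (left_mem_latt _ _) (smul_mem_latt norm_q_le_one (right_mem_latt _ _))

/-- `1 ∈ mult [α, β]`. [folklore] -/
theorem one_mem_mult (α β : QuadraticAlgebra ℚ_[q] a b) : (1 : QuadraticAlgebra ℚ_[q] a b) ∈ mult α β :=
  mem_mult_iff.mpr fun z hz => by rwa [one_mul]

/-- `mult [α, β]` is closed under addition. [folklore] -/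
theorem add_mem_mult {α β κ κ' : QuadraticAlgebra ℚ_[q] a b} (h : κ ∈ mult α β) (h' : κ' ∈ mult α β) :
    κ + κ' ∈ mult α β :=
  mem_mult_iff.mpr fun z hz => by
    rw [add_mul]; exact add_mem_latt (mem_mult_iff.mp h z hz) (mem_mult_iff.mp h' z hz)

/-- `mult [α, β]` is a `ℤ_q`-module. [folklore] -/
theorem smul_mem_mult {α β κ : QuadraticAlgebra ℚ_[q] a b} {c : ℚ_[q]} (hc : ‖c‖ ≤ 1) (h : κ ∈ mult α β) :
    c • κ ∈ mult α β :=
  mem_mult_iff.mpr fun z hz => by rw [smul_mul_assoc]; exact smul_mem_latt hc (mem_mult_iff.mp h z hz)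

/-- If `τ ∈ mult [α, β]` then `[1, τ] ⊆ mult [α, β]`. [folklore] -/
theorem latt_one_subset_mult {α β τ : QuadraticAlgebra ℚ_[q] a b} (hτ : τ ∈ mult α β) :
    latt 1 τ ⊆ mult α β := by
  rintro _ ⟨u, v, hu, hv, rfl⟩
  exact add_mem_mult (smul_mem_mult hu (one_mem_mult _ _)) (smul_mem_mult hv hτ)

/-- Membership in `[τ, q·1]` by coordinates. [folklore] -/
theorem smul_add_smul_smul_one_mem_latt {τ : QuadraticAlgebra ℚ_[q] a b} {u v : ℚ_[q]} (hu : ‖u‖ ≤ 1)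
    (hv : ‖v‖ ≤ 1) : u • τ + v • ((q : ℚ_[q]) • (1 : QuadraticAlgebra ℚ_[q] a b)) ∈ latt τ ((q : ℚ_[q]) • 1) :=
  ⟨u, v, hu, hv, rfl⟩

/-! ### The invariant `R ∩ mult L'` of the `q + 1` sublattices -/

/-- **Case `L' = [1, qσ]`**: `mult[1, σ] ∩ mult[1, qσ] = [1, qσ]`. [cite: VignerasLNM800, Ch. II §3] -/
theorem mult_one_inter_mult_one_smul {σ : QuadraticAlgebra ℚ_[q] a b} (hσ : σ.im ≠ 0)
    (hring : σ * σ ∈ latt 1 σ) :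
    mult 1 σ ∩ mult 1 ((q : ℚ_[q]) • σ) = latt 1 ((q : ℚ_[q]) • σ) := by
  rw [mult_one_eq_latt hring, mult_one_eq_latt (ring_smul hσ hring)]
  exact Set.inter_eq_right.mpr (latt_one_smul_subset σ)

/-- **Case `L' = [σ, q]` with `q ∣ N(σ)`** (an `R`-ideal): `σ ∈ mult[σ, q]`, hence
`mult[1, σ] ∩ mult[σ, q] = [1, σ]`. [cite: VignerasLNM800, Ch. II §3] -/
theorem mult_one_inter_mult_smul_of_norm_lt {σ : QuadraticAlgebra ℚ_[q] a b} (hσ : σ.im ≠ 0)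
    (hring : σ * σ ∈ latt 1 σ) (hN : ‖σ.norm‖ < 1) :
    mult 1 σ ∩ mult σ ((q : ℚ_[q]) • 1) = latt 1 σ := by
  have hq0 : (q : ℚ_[q]) ≠ 0 := Nat.cast_ne_zero.mpr hq.out.ne_zero
  obtain ⟨ht, -⟩ := (mul_self_mem_latt_one_iff hσ).mp hring
  obtain ⟨y, hy, hyN⟩ := (norm_lt_one_iff_exists _).mp hN
  have hσm : σ ∈ mult σ ((q : ℚ_[q]) • 1) := by
    refine ⟨?_, ?_⟩
    · rw [mul_self_eq, Algebra.algebraMap_eq_smul_one, hyN]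
      exact ⟨tr σ, -y, ht, by rw [norm_neg]; exact hy, by module⟩
    · rw [mul_smul_comm, mul_one]
      exact smul_mem_latt norm_q_le_one (left_mem_latt _ _)
  rw [mult_one_eq_latt hring]
  exact Set.inter_eq_left.mpr (latt_one_subset_mult hσm)

/-- **Case `L' = [σ, q]` with `q ∤ N(σ)`**: `mult[1, σ] ∩ mult[σ, q] = [1, qσ]`. [cite: VignerasLNM800, Ch. II §3] -/
theorem mult_one_inter_mult_smul_of_norm_eq_one {σ : QuadraticAlgebra ℚ_[q] a b} (hσ : σ.im ≠ 0)
    (hring : σ * σ ∈ latt 1 σ) (hN : ‖σ.norm‖ = 1) :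
    mult 1 σ ∩ mult σ ((q : ℚ_[q]) • 1) = latt 1 ((q : ℚ_[q]) • σ) := by
  have hq0 : (q : ℚ_[q]) ≠ 0 := Nat.cast_ne_zero.mpr hq.out.ne_zero
  obtain ⟨ht, hNle⟩ := (mul_self_mem_latt_one_iff hσ).mp hring
  rw [mult_one_eq_latt hring]
  apply Set.Subset.antisymm
  · rintro κ ⟨⟨u, v, hu, hv, rfl⟩, hκσ, -⟩
    -- `κσ = (u + v tr σ) σ - v N(σ)`, and it lies in `[σ, q]`: so `q ∣ v`
    have e : (u • (1 : QuadraticAlgebra ℚ_[q] a b) + v • σ) * σ =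
        (-(v * σ.norm)) • 1 + (u + v * tr σ) • σ := by
      rw [add_mul, smul_mul_assoc, smul_mul_assoc, one_mul, mul_self_eq, Algebra.algebraMap_eq_smul_one,
        smul_sub, smul_smul, smul_smul]
      module
    obtain ⟨u', v', -, hv', h'⟩ := hκσ
    rw [e, smul_smul, add_comm (u' • σ)] at h'
    obtain ⟨h1, -⟩ := smul_one_add_smul_inj hσ h'
    have hvn : ‖v‖ < 1 := by
      have : ‖v‖ = ‖v' * (q : ℚ_[q])‖ := by
        rw [← norm_neg, ← mul_one ‖-v‖, ← hN, ← norm_mul, neg_mul, h1]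
      rw [this, norm_mul, Padic.norm_p]
      calc ‖v'‖ * (q : ℝ)⁻¹ ≤ 1 * (q : ℝ)⁻¹ := by gcongr
        _ < 1 := by rw [one_mul]; exact inv_lt_one_of_one_lt₀ (by exact_mod_cast hq.out.one_lt)
    obtain ⟨y, hy, rfl⟩ := (norm_lt_one_iff_exists v).mp hvn
    exact ⟨u, y, hu, hy, by module⟩
  · refine Set.subset_inter (latt_one_smul_subset σ) (latt_one_subset_mult ⟨?_, ?_⟩)
    · rw [smul_mul_assoc, mul_self_eq, Algebra.algebraMap_eq_smul_one]
      refine ⟨(q : ℚ_[q]) * tr σ, -σ.norm, ?_, ?_, by module⟩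
      · rw [norm_mul]; exact mul_le_one₀ norm_q_le_one (norm_nonneg _) ht
      · rw [norm_neg]; exact hNle
    · rw [smul_mul_assoc, mul_smul_comm, mul_one, smul_smul]
      exact ⟨(q : ℚ_[q]) * q, 0, by rw [norm_mul]; exact mul_le_one₀ norm_q_le_one (norm_nonneg _) norm_q_le_one,
        by simp, by module⟩

/-! ### The non-ideal lines form one orbit; distinct ideal lines are distinct -/

/-- A unit `w` of the ring lattice `[1, σ]` (`w, w⁻¹ ∈ [1, σ]`) has `w[1, σ] = [1, σ]`. [folklore] -/
theorem image_mul_latt_one_eq {σ w w' : QuadraticAlgebra ℚ_[q] a b} (hring : σ * σ ∈ latt 1 σ)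
    (hw : w ∈ latt 1 σ) (hw' : w' ∈ latt 1 σ) (hww' : w * w' = 1) :
    (fun z => w * z) '' latt 1 σ = latt 1 σ := by
  have h := image_mul_eq_of_unit (lam := 1) hring hw hw' hww'
  simpa only [one_mul, Set.image_id'] using h

/-- **The orbit lemma**: if `q ∤ N(σ)` then `σ` is a unit of `R = [1, σ]` and `σ · [1, qσ'] = [σ, q]`
where `σ = σ' + k`; stated for `σ' = σ - k`: `σ [1, q(σ - k)] = [σ, q]`. Concretely we use it as
`σ [1, σ] = [1, σ]` and `σ [1, qτ] = [σ, q]` for any ring generator `τ` with `[1, τ] = [1, σ]`. [cite: VignerasLNM800, Ch. II §3] -/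
theorem image_mul_latt_one_smul {σ τ : QuadraticAlgebra ℚ_[q] a b} (hσ : σ.im ≠ 0)
    (hring : σ * σ ∈ latt 1 σ) (hστ : latt 1 τ = latt 1 σ) (hN : ‖σ.norm‖ = 1) :
    (fun z => σ * z) '' latt 1 σ = latt 1 σ ∧
      (fun z => σ * z) '' latt 1 ((q : ℚ_[q]) • τ) = latt σ ((q : ℚ_[q]) • 1) := by
  obtain ⟨ht, hNle⟩ := (mul_self_mem_latt_one_iff hσ).mp hring
  have hN0 : σ.norm ≠ 0 := fun h => by rw [h, norm_zero] at hN; exact zero_ne_one hN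
  have hNi : ‖σ.norm⁻¹‖ = 1 := by rw [norm_inv, hN, inv_one]
  -- the inverse `σ⁻¹ = N⁻¹ (tr σ - σ)` lies in `[1, σ]`
  set w' : QuadraticAlgebra ℚ_[q] a b := σ.norm⁻¹ • (tr σ • 1 - σ) with hw'
  have hw'mem : w' ∈ latt 1 σ := by
    refine ⟨σ.norm⁻¹ * tr σ, -σ.norm⁻¹, ?_, ?_, by rw [hw']; module⟩
    · rw [norm_mul, hNi, one_mul]; exact ht
    · rw [norm_neg, hNi]
  have hσw' : σ * w' = 1 := by
    rw [hw', mul_smul_comm, mul_sub, mul_smul_comm, mul_one, mul_self_eq, Algebra.algebraMap_eq_smul_one,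
      sub_sub_cancel, smul_smul, inv_mul_cancel₀ hN0, one_smul]
  refine ⟨image_mul_latt_one_eq hring (right_mem_latt 1 σ) hw'mem hσw', ?_⟩
  -- `σ [1, qτ] = [σ, q σ τ]` and `σ τ = (c + d σ)` from `τ ∈ [1, σ]`, `στ ∈ [1,σ]`…: use coordinates of `qστ`
  rw [← latt_mul, mul_one]
  -- `τ = a₁ + b₁ σ` with `b₁` a unit (since `[1, τ] = [1, σ]`)
  obtain ⟨a₁, b₁, ha₁, hb₁, hτe⟩ : τ ∈ latt 1 σ := hστ ▸ right_mem_latt 1 τ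
  have e : σ * ((q : ℚ_[q]) • τ) = ((q : ℚ_[q]) * (a₁ + b₁ * tr σ)) • σ + (-(b₁ * σ.norm)) • ((q : ℚ_[q]) • 1) := by
    rw [hτe, mul_smul_comm, mul_add, mul_smul_comm, mul_smul_comm, mul_one, mul_self_eq,
      Algebra.algebraMap_eq_smul_one, smul_sub, smul_smul, smul_add, smul_smul, smul_sub, smul_smul, smul_smul,
      smul_smul, smul_smul]
    module
  -- `b₁` is a unit: `σ ∈ [1, τ]` gives `σ = a₂ + b₂ τ = (a₂ + b₂ a₁) + b₂ b₁ σ`, so `b₂ b₁ = 1`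
  obtain ⟨a₂, b₂, -, hb₂, hσe⟩ : σ ∈ latt 1 τ := hστ.symm ▸ right_mem_latt 1 σ
  have hb₁u : ‖b₁‖ = 1 := by
    have e2 : (0 : ℚ_[q]) • (1 : QuadraticAlgebra ℚ_[q] a b) + (1 : ℚ_[q]) • σ = (a₂ + b₂ * a₁) • 1 + (b₂ * b₁) • σ := by
      rw [zero_smul, zero_add, one_smul]
      conv_lhs => rw [hσe, hτe]
      module
    have h1 := (smul_one_add_smul_inj hσ e2).2
    have : ‖b₂‖ * ‖b₁‖ = 1 := by rw [← norm_mul, ← h1, norm_one]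
    refine le_antisymm hb₁ ?_
    by_contra hlt
    push Not at hlt
    have : ‖b₂‖ * ‖b₁‖ < 1 := mul_lt_one_of_nonneg_of_lt_one_right hb₂ (norm_nonneg _) hlt
    linarith
  refine latt_eq_of_unimodular (m₀₀ := 1) (m₀₁ := 0) (m₁₀ := (q : ℚ_[q]) * (a₁ + b₁ * tr σ))
    (m₁₁ := -(b₁ * σ.norm)) (by simp) (by simp) ?_ ?_ ?_ (by rw [one_smul, zero_smul, add_zero]) e
  · rw [norm_mul]
    refine mul_le_one₀ norm_q_le_one (norm_nonneg _) ((Padic.nonarchimedean _ _).trans (max_le ha₁ ?_))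
    rw [norm_mul]; exact mul_le_one₀ hb₁ (norm_nonneg _) ht
  · rw [norm_neg, norm_mul]; exact mul_le_one₀ hb₁ (norm_nonneg _) hNle
  · rw [one_mul, zero_mul, sub_zero, norm_neg, norm_mul, hb₁u, hN, one_mul]

/-- **Distinct ideal lines**: `[σ + k, q] = [σ + k', q]` iff `q ∣ k - k'`. [folklore] -/
theorem latt_add_smul_one_smul_eq_iff {σ : QuadraticAlgebra ℚ_[q] a b} (hσ : σ.im ≠ 0) (k k' : ℚ_[q]) :
    latt (σ + k • 1) ((q : ℚ_[q]) • 1) = latt (σ + k' • 1) ((q : ℚ_[q]) • 1) ↔ ‖k - k'‖ < 1 := by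
  constructor
  · intro h
    obtain ⟨u, v, -, hv, huv⟩ : σ + k • 1 ∈ latt (σ + k' • 1) ((q : ℚ_[q]) • 1) := h ▸ left_mem_latt _ _
    have e : (k : ℚ_[q]) • (1 : QuadraticAlgebra ℚ_[q] a b) + (1 : ℚ_[q]) • σ =
        (u * k' + v * q) • 1 + u • σ := by
      rw [one_smul, add_comm]
      conv_lhs => rw [huv]
      rw [smul_add, smul_smul, smul_smul]
      module
    obtain ⟨h1, h2⟩ := smul_one_add_smul_inj hσ e
    rw [← h2, one_mul] at h1
    rw [show k - k' = v * q by linear_combination h1, norm_mul, Padic.norm_p]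
    calc ‖v‖ * (q : ℝ)⁻¹ ≤ 1 * (q : ℝ)⁻¹ := by gcongr
      _ < 1 := by rw [one_mul]; exact inv_lt_one_of_one_lt₀ (by exact_mod_cast hq.out.one_lt)
  · intro h
    obtain ⟨y, hy, hyk⟩ := (norm_lt_one_iff_exists _).mp h
    refine latt_eq_of_unimodular (m₀₀ := 1) (m₀₁ := y) (m₁₀ := 0) (m₁₁ := 1) (by simp) hy (by simp) (by simp)
      (by simp) ?_ (by rw [zero_smul, zero_add, one_smul])
    rw [one_smul, smul_smul, mul_comm y, ← hyk, sub_smul]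
    abel

/-- **Ideal lines are not the line of `1`**: `[σ + k, q] ≠ [1, qτ]` for any `τ` (the element
`σ + k` has unit `σ`-coordinate). [folklore] -/
theorem latt_add_smul_one_smul_ne {σ τ : QuadraticAlgebra ℚ_[q] a b} (hσ : σ.im ≠ 0) (hστ : latt 1 τ = latt 1 σ)
    {k : ℚ_[q]} : latt (σ + k • 1) ((q : ℚ_[q]) • 1) ≠ latt 1 ((q : ℚ_[q]) • τ) := by
  intro h
  obtain ⟨a₁, b₁, -, hb₁, hτe⟩ : τ ∈ latt 1 σ := hστ ▸ right_mem_latt 1 τ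
  obtain ⟨u, v, -, hv, huv⟩ : σ + k • 1 ∈ latt 1 ((q : ℚ_[q]) • τ) := h ▸ left_mem_latt _ _
  have e : (k : ℚ_[q]) • (1 : QuadraticAlgebra ℚ_[q] a b) + (1 : ℚ_[q]) • σ = (u + v * q * a₁) • 1 + (v * q * b₁) • σ := by
    rw [one_smul, add_comm]
    conv_lhs => rw [huv, hτe]
    rw [smul_smul, smul_add, smul_smul, smul_smul]
    module
  obtain ⟨-, h2⟩ := smul_one_add_smul_inj hσ e
  have : ‖v * (q : ℚ_[q]) * b₁‖ < 1 := by
    rw [norm_mul, norm_mul, Padic.norm_p]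
    calc ‖v‖ * (q : ℝ)⁻¹ * ‖b₁‖ ≤ 1 * (q : ℝ)⁻¹ * 1 := by gcongr
      _ < 1 := by rw [one_mul, mul_one]; exact inv_lt_one_of_one_lt₀ (by exact_mod_cast hq.out.one_lt)
  rw [← h2, norm_one] at this
  exact lt_irrefl _ this

/-- **Uniqueness of the over-order**: two ring lattices `[1, σ₁]`, `[1, σ₂]` with
`[1, qσ₁] = [1, qσ₂]` coincide (the `1`-coordinate `y` of `σ₂` on `(1, σ₁)` has `q y, y² + y·s`
integral, forcing `y` integral). [folklore] -/
theorem latt_one_subset_of_latt_one_smul_eq {σ₁ σ₂ : QuadraticAlgebra ℚ_[q] a b} (hσ₁ : σ₁.im ≠ 0)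
    (hring₁ : σ₁ * σ₁ ∈ latt 1 σ₁) (hring₂ : σ₂ * σ₂ ∈ latt 1 σ₂)
    (h : latt 1 ((q : ℚ_[q]) • σ₁) = latt 1 ((q : ℚ_[q]) • σ₂)) : σ₂ ∈ latt 1 σ₁ := by
  have hq0 : (q : ℚ_[q]) ≠ 0 := Nat.cast_ne_zero.mpr hq.out.ne_zero
  have hσ₂ : σ₂.im ≠ 0 := by
    intro h0
    -- `qσ₁ ∈ [1, qσ₂]` would then have zero `im`
    obtain ⟨u, v, -, -, huv⟩ : (q : ℚ_[q]) • σ₁ ∈ latt 1 ((q : ℚ_[q]) • σ₂) := h ▸ right_mem_latt _ _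
    have := congrArg QuadraticAlgebra.im huv
    simp [QuadraticAlgebra.im_one, h0, hq0, hσ₁] at this
  obtain ⟨ht₁, hN₁⟩ := (mul_self_mem_latt_one_iff hσ₁).mp hring₁
  obtain ⟨ht₂, hN₂⟩ := (mul_self_mem_latt_one_iff hσ₂).mp hring₂
  obtain ⟨a₂, b₂, ha₂, hb₂, he⟩ : (q : ℚ_[q]) • σ₂ ∈ latt 1 ((q : ℚ_[q]) • σ₁) := h.symm ▸ right_mem_latt _ _
  -- `σ₂ = y + b₂ σ₁` with `y = a₂ / q`
  set y := a₂ / (q : ℚ_[q]) with hy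
  have hσ₂e : σ₂ = y • 1 + b₂ • σ₁ := by
    have : σ₂ = (q : ℚ_[q])⁻¹ • ((q : ℚ_[q]) • σ₂) := by rw [smul_smul, inv_mul_cancel₀ hq0, one_smul]
    rw [this, he, smul_add, smul_smul, smul_smul, smul_smul, hy, div_eq_inv_mul, mul_right_comm,
      inv_mul_cancel₀ hq0, one_mul]
  -- `tr σ₂ = 2y + b₂ tr σ₁`, `N σ₂ = y² + y b₂ tr σ₁ + b₂² N σ₁`
  have htr : tr σ₂ = 2 * y + b₂ * tr σ₁ := by
    rw [hσ₂e]; simp [tr, QuadraticAlgebra.re_one, QuadraticAlgebra.im_one]; ring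
  have hnm : σ₂.norm = y ^ 2 + y * b₂ * tr σ₁ + b₂ ^ 2 * σ₁.norm := by rw [hσ₂e, norm_smul_one_add_smul]
  have hs : ‖b₂ * tr σ₁‖ ≤ 1 := by rw [norm_mul]; exact mul_le_one₀ hb₂ (norm_nonneg _) ht₁
  have hyy : ‖y ^ 2 + y * (b₂ * tr σ₁)‖ ≤ 1 := by
    have : y ^ 2 + y * (b₂ * tr σ₁) = σ₂.norm - b₂ ^ 2 * σ₁.norm := by rw [hnm]; ring
    rw [this]
    refine (norm_sub_le_max _ _).trans (max_le hN₂ ?_)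
    rw [norm_mul, norm_pow]; exact mul_le_one₀ (pow_le_one₀ (norm_nonneg _) hb₂) (norm_nonneg _) hN₁
  have hyle : ‖y‖ ≤ 1 := by
    by_contra hlt
    push Not at hlt
    have hy0 : 0 < ‖y‖ := zero_lt_one.trans hlt
    have h1 : ‖y * (b₂ * tr σ₁)‖ < ‖y ^ 2‖ := by
      rw [norm_mul, norm_pow, sq]
      calc ‖y‖ * ‖b₂ * tr σ₁‖ ≤ ‖y‖ * 1 := by gcongr
        _ < ‖y‖ * ‖y‖ := by rw [mul_one]; exact lt_mul_of_one_lt_right hy0 hlt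
    have h2 : ‖y ^ 2 + y * (b₂ * tr σ₁)‖ = ‖y ^ 2‖ := by
      rw [add_comm]; exact Padic.add_eq_max_of_ne h1.ne ▸ max_eq_right h1.le
    rw [h2, norm_pow] at hyy
    have : (1 : ℝ) < ‖y‖ ^ 2 := one_lt_pow₀ hlt two_ne_zero
    linarith
  rw [hσ₂e]
  exact ⟨y, b₂, hyle, hb₂, rfl⟩

/-- Two ring lattices with the same `ℤ_q + q(·)` are equal. [folklore] -/
theorem latt_one_eq_of_latt_one_smul_eq {σ₁ σ₂ : QuadraticAlgebra ℚ_[q] a b} (hσ₁ : σ₁.im ≠ 0) (hσ₂ : σ₂.im ≠ 0)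
    (hring₁ : σ₁ * σ₁ ∈ latt 1 σ₁) (hring₂ : σ₂ * σ₂ ∈ latt 1 σ₂)
    (h : latt 1 ((q : ℚ_[q]) • σ₁) = latt 1 ((q : ℚ_[q]) • σ₂)) : latt 1 σ₁ = latt 1 σ₂ :=
  Set.Subset.antisymm
    (latt_subset_of_mem (left_mem_latt _ _) (latt_one_subset_of_latt_one_smul_eq hσ₂ hring₂ hring₁ h.symm))
    (latt_subset_of_mem (left_mem_latt _ _) (latt_one_subset_of_latt_one_smul_eq hσ₁ hring₁ hring₂ h))

/-- `[1, qσ] ≠ [1, σ]` for `σ ∉ ℚ_q`. [folklore] -/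
theorem latt_one_smul_ne {σ : QuadraticAlgebra ℚ_[q] a b} (hσ : σ.im ≠ 0) : latt 1 ((q : ℚ_[q]) • σ) ≠ latt 1 σ := by
  intro h
  obtain ⟨u, v, -, hv, huv⟩ : σ ∈ latt 1 ((q : ℚ_[q]) • σ) := h.symm ▸ right_mem_latt 1 σ
  have e : (0 : ℚ_[q]) • (1 : QuadraticAlgebra ℚ_[q] a b) + (1 : ℚ_[q]) • σ = u • 1 + (v * q) • σ := by
    rw [zero_smul, zero_add, one_smul]; conv_lhs => rw [huv]; rw [smul_smul]
  obtain ⟨-, h2⟩ := smul_one_add_smul_inj hσ e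
  have : ‖v * (q : ℚ_[q])‖ < 1 := by
    rw [norm_mul, Padic.norm_p]
    calc ‖v‖ * (q : ℝ)⁻¹ ≤ 1 * (q : ℝ)⁻¹ := by gcongr
      _ < 1 := by rw [one_mul]; exact inv_lt_one_of_one_lt₀ (by exact_mod_cast hq.out.one_lt)
  rw [← h2, norm_one] at this
  exact lt_irrefl _ this


/-- A unit of the multiplier ring with inverse in the multiplier ring acts bijectively on the
lattice. [folklore] -/
theorem image_mul_latt_eq_of_mem_mult {α β κ w : QuadraticAlgebra ℚ_[q] a b} (hκ : κ ∈ mult α β)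
    (hw : w ∈ mult α β) (hκw : κ * w = 1) : (fun z => κ * z) '' latt α β = latt α β := by
  apply Set.Subset.antisymm
  · rintro _ ⟨z, hz, rfl⟩
    exact mem_mult_iff.mp hκ z hz
  · intro z hz
    exact ⟨w * z, mem_mult_iff.mp hw z hz, by change κ * (w * z) = z; rw [← mul_assoc, hκw, one_mul]⟩

/-- Transport of multiplier rings along a unit image: `[α, β] = κ[α', β']` with `κ` a unit gives
`mult[α, β] = mult[α', β']`. [folklore] -/
theorem mult_eq_of_latt_eq_image {α β α' β' κ : QuadraticAlgebra ℚ_[q] a b} (hκ : IsUnit κ)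
    (h : latt α β = (fun z => κ * z) '' latt α' β') : mult α β = mult α' β' := by
  rw [← latt_mul] at h
  rw [mult_congr h, mult_mul_of_isUnit hκ]

/-- `det(1, τ) ≠ 0` for `τ ∉ ℚ_q`. [folklore] -/
theorem det_one_left {τ : QuadraticAlgebra ℚ_[q] a b} (hτ : τ.im ≠ 0) :
    (1 : QuadraticAlgebra ℚ_[q] a b).re * τ.im - τ.re * (1 : QuadraticAlgebra ℚ_[q] a b).im ≠ 0 := by
  change (1 : ℚ_[q]) * τ.im - τ.re * 0 ≠ 0
  simpa using hτ

/-- `det(σ + k, q) = -q σ.im ≠ 0` for `σ ∉ ℚ_q`. [folklore] -/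
theorem det_add_smul_one_smul_one {σ : QuadraticAlgebra ℚ_[q] a b} (hσ : σ.im ≠ 0) (k : ℚ_[q]) :
    (σ + k • 1).re * ((q : ℚ_[q]) • (1 : QuadraticAlgebra ℚ_[q] a b)).im -
      ((q : ℚ_[q]) • (1 : QuadraticAlgebra ℚ_[q] a b)).re * (σ + k • 1).im ≠ 0 := by
  have e : (σ + k • 1).re * ((q : ℚ_[q]) • (1 : QuadraticAlgebra ℚ_[q] a b)).im -
      ((q : ℚ_[q]) • (1 : QuadraticAlgebra ℚ_[q] a b)).re * (σ + k • 1).im = -((q : ℚ_[q]) * σ.im) := by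
    simp only [QuadraticAlgebra.re_add, QuadraticAlgebra.im_add, QuadraticAlgebra.re_smul,
      QuadraticAlgebra.im_smul, QuadraticAlgebra.re_one, QuadraticAlgebra.im_one, smul_eq_mul]
    ring
  rw [e, neg_ne_zero]
  exact mul_ne_zero (Nat.cast_ne_zero.mpr hq.out.ne_zero) hσ

/-- The norm of a ring generator is integral. [folklore] -/
theorem norm_norm_le_one_of_ring {σ : QuadraticAlgebra ℚ_[q] a b} (hσ : σ.im ≠ 0)
    (hring : σ * σ ∈ latt 1 σ) : ‖σ.norm‖ ≤ 1 :=
  ((mul_self_mem_latt_one_iff hσ).mp hring).2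

/-- `((λσ) ·) '' S = λ '' (σ '' S)`. [folklore] -/
theorem image_mul_mul {lam σ : QuadraticAlgebra ℚ_[q] a b} (S : Set (QuadraticAlgebra ℚ_[q] a b)) :
    (fun z => lam * σ * z) '' S = (fun z => lam * z) '' ((fun z => σ * z) '' S) := by
  rw [Set.image_image]
  exact Set.image_congr fun z _ => mul_assoc _ _ _

end Pairs

/-! ### `ℤ_q`-points and integers: approximation of `q`-adic integers by naturals -/

section Approx

variable {q : ℕ} [hq : Fact q.Prime]

/-- Every `k ∈ ℤ_q` is within `q^{-n}` of a natural number `< q^n`. [folklore] -/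
theorem exists_nat_norm_sub_le {k : ℚ_[q]} (hk : ‖k‖ ≤ 1) (n : ℕ) :
    ∃ m : ℕ, m < q ^ n ∧ ‖k - m‖ ≤ (q : ℝ) ^ (-(n : ℤ)) := by
  set x : ℤ_[q] := ⟨k, hk⟩ with hx
  refine ⟨x.appr n, PadicInt.appr_lt x n, ?_⟩
  have h := PadicInt.appr_spec n x
  rw [← PadicInt.norm_le_pow_iff_mem_span_pow, PadicInt.norm_def, PadicInt.coe_sub] at h
  simpa [hx] using h

/-- Every `k ∈ ℤ_q` is within `< 1` of a natural number `< q`. [folklore] -/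
theorem exists_nat_lt_norm_sub_lt_one {k : ℚ_[q]} (hk : ‖k‖ ≤ 1) : ∃ m : ℕ, m < q ∧ ‖k - m‖ < 1 := by
  obtain ⟨m, hm, hkm⟩ := exists_nat_norm_sub_le hk 1
  refine ⟨m, by simpa using hm, ?_⟩
  rw [norm_lt_one_iff_le_inv]
  simpa using hkm

end Approx

/-! ### The level-`q` dictionary: `x O_(q) ↦ (Φ(x) ℤ_q², Φ(x)(ℤ_q ⊕ q ℤ_q))` -/

section LevelDictionary

variable {D : Type u} [Ring D] [Algebra ℚ D] {q : ℕ} [hq : Fact q.Prime]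
  (Φ : D →ₐ[ℚ] Matrix (Fin 2) (Fin 2) ℚ_[q]) {O : Submodule ℤ D}

/-- The matrix `D_q = diag(1, q)`; `O_q = M₂(ℤ_q) ∩ D_q M₂(ℤ_q) D_q⁻¹` is the Eichler order of level
`q` (Vignéras II §2 Lemme 2.4). [cite: VignerasLNM800, Ch. II §2 Lemme 2.4] -/
def diagQ (q : ℕ) [Fact q.Prime] : Matrix (Fin 2) (Fin 2) ℚ_[q] := !![(1 : ℚ_[q]), 0; 0, (q : ℚ_[q])]

/-- `det D_q = q` is a unit of `ℚ_q`. [folklore] -/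
theorem isUnit_det_diagQ : IsUnit (diagQ q).det := by
  rw [isUnit_iff_ne_zero, diagQ, Matrix.det_fin_two_of]
  simp [hq.out.ne_zero]

/-- The columns of `g D_q` are `g₀` and `q g₁`. [folklore] -/
theorem colLatt_mul_diagQ (g : Matrix (Fin 2) (Fin 2) ℚ_[q]) :
    colLatt (g * diagQ q) = vlatt (g.col 0) ((q : ℚ_[q]) • g.col 1) := by
  have h0 : (g * diagQ q).col 0 = g.col 0 := by
    ext i; simp [diagQ, Matrix.mul_apply, Fin.sum_univ_two, Matrix.col_apply]
  have h1 : (g * diagQ q).col 1 = (q : ℚ_[q]) • g.col 1 := by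
    ext i; simp [diagQ, Matrix.mul_apply, Fin.sum_univ_two, Matrix.col_apply, mul_comm]
  rw [colLatt, h0, h1]

/-- **The Eichler condition in lattice form**: for `g ∈ GL₂(ℚ_q)`, `g⁻¹ g'` lies in
`(ℤ_q ℤ_q; q ℤ_q ℤ_q)` iff `g' ℤ_q² ⊆ g ℤ_q²` and `g' D_q ℤ_q² ⊆ g D_q ℤ_q²`. [cite: VignerasLNM800, Ch. II §2 Lemme 2.4] -/
theorem eichler_iff_colLatt {g : Matrix (Fin 2) (Fin 2) ℚ_[q]} (hg : IsUnit g.det)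
    (g' : Matrix (Fin 2) (Fin 2) ℚ_[q]) :
    ((∀ i j, ‖(g⁻¹ * g') i j‖ ≤ 1) ∧ ‖(g⁻¹ * g') 1 0‖ ≤ (q : ℝ)⁻¹) ↔
      colLatt g' ⊆ colLatt g ∧ colLatt (g' * diagQ q) ⊆ colLatt (g * diagQ q) := by
  have hq0 : (q : ℚ_[q]) ≠ 0 := Nat.cast_ne_zero.mpr hq.out.ne_zero
  have hd : ‖(q : ℚ_[q])‖ = (q : ℝ) ^ (-((1 : ℕ) : ℤ)) * ‖(1 : ℚ_[q])‖ := by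
    rw [norm_one, mul_one, Padic.norm_p]; simp
  have h := Padic.integral_and_diag_conj_integral_iff (one_ne_zero) hq0 hd (g⁻¹ * g')
  simp only [Nat.cast_one, zpow_neg, zpow_one] at h
  rw [← h, colLatt_subset_iff hg, colLatt_subset_iff (by rw [Matrix.det_mul]; exact hg.mul isUnit_det_diagQ),
    Matrix.mul_inv_rev, diagQ]
  simp only [Matrix.mul_assoc]

/-- **`y ∈ x O_(q)` in lattice form** for a level-`q` model `O_(q) = Φ⁻¹(ℤ_q ℤ_q; q ℤ_q ℤ_q)`. [cite: VignerasLNM800, Ch. II §3] -/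
theorem mem_smul_localAt_iff_level
    (hO : ∀ y : D, y ∈ localAt q O ↔ (∀ i j, ‖Φ y i j‖ ≤ 1) ∧ ‖Φ y 1 0‖ ≤ (q : ℝ)⁻¹) (x : Dˣ) (y : D) :
    y ∈ x • localAt q O ↔ colLatt (Φ y) ⊆ colLatt (Φ (x : D)) ∧
      colLatt (Φ y * diagQ q) ⊆ colLatt (Φ (x : D) * diagQ q) := by
  rw [mem_units_smul_submodule_iff, Units.smul_def, smul_eq_mul, hO, map_mul, ← inv_map_units,
    eichler_iff_colLatt (isUnit_det_map_units Φ x)]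

/-- `x O_(q) = x' O_(q)` if `Λ_x = Λ_{x'}` and `Λ'_x = Λ'_{x'}`. [folklore] -/
theorem smul_localAt_eq_of_colLatt_eq_level
    (hO : ∀ y : D, y ∈ localAt q O ↔ (∀ i j, ‖Φ y i j‖ ≤ 1) ∧ ‖Φ y 1 0‖ ≤ (q : ℝ)⁻¹) {x x' : Dˣ}
    (h : colLatt (Φ (x : D)) = colLatt (Φ (x' : D)))
    (h' : colLatt (Φ (x : D) * diagQ q) = colLatt (Φ (x' : D) * diagQ q)) :
    x • localAt q O = x' • localAt q O := by
  ext y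
  rw [mem_smul_localAt_iff_level Φ hO, mem_smul_localAt_iff_level Φ hO, h, h']

/-- Conversely `x O_(q) = x' O_(q)` forces `Λ_x = Λ_{x'}` and `Λ'_x = Λ'_{x'}`. [folklore] -/
theorem colLatt_eq_of_smul_localAt_eq_level
    (hO : ∀ y : D, y ∈ localAt q O ↔ (∀ i j, ‖Φ y i j‖ ≤ 1) ∧ ‖Φ y 1 0‖ ≤ (q : ℝ)⁻¹)
    (hO1 : (1 : D) ∈ O) {x x' : Dˣ} (h : x • localAt q O = x' • localAt q O) :
    colLatt (Φ (x : D)) = colLatt (Φ (x' : D)) ∧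
      colLatt (Φ (x : D) * diagQ q) = colLatt (Φ (x' : D) * diagQ q) := by
  have hmem : ∀ z : Dˣ, (z : D) ∈ z • localAt q O := fun z => by
    rw [mem_units_smul_submodule_iff, Units.smul_def, smul_eq_mul, Units.inv_mul]
    exact le_localAt q O hO1
  have h1 := (mem_smul_localAt_iff_level Φ hO x' x).mp (h ▸ hmem x)
  have h2 := (mem_smul_localAt_iff_level Φ hO x x').mp (h.symm ▸ hmem x')
  exact ⟨Set.Subset.antisymm h1.1 h2.1, Set.Subset.antisymm h1.2 h2.2⟩

/-- **The left order of `x O_(q)` in lattice form**: `h ∈ O_L(x O_(q))` iff `Φ(h)` preserves both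
`Λ_x` and `Λ'_x`. [cite: VignerasLNM800, Ch. II §3] -/
theorem mem_leftOrder_smul_localAt_iff_image_level
    (hO : ∀ y : D, y ∈ localAt q O ↔ (∀ i j, ‖Φ y i j‖ ≤ 1) ∧ ‖Φ y 1 0‖ ≤ (q : ℝ)⁻¹)
    (hO1 : (1 : D) ∈ O) (hOmul : ∀ a ∈ O, ∀ b ∈ O, a * b ∈ O) (x : Dˣ) (h : D) :
    h ∈ leftOrder (x • localAt q O) ↔
      (Φ h).mulVec '' colLatt (Φ (x : D)) ⊆ colLatt (Φ (x : D)) ∧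
        (Φ h).mulVec '' colLatt (Φ (x : D) * diagQ q) ⊆ colLatt (Φ (x : D) * diagQ q) := by
  rw [mem_leftOrder_smul_localAt_iff hO1 hOmul, mem_smul_localAt_iff_level Φ hO, map_mul, colLatt_mul,
    mul_assoc, colLatt_mul]

end LevelDictionary

/-! ### Optimal orders at level `q`, density, and transitivity -/

section LevelOptimal

variable {D : Type u} [Ring D] [Algebra ℚ D] [IsQuaternionAlgebra ℚ D] {q : ℕ} [hq : Fact q.Prime]
  (Φ : D →ₐ[ℚ] Matrix (Fin 2) (Fin 2) ℚ_[q]) {O : Submodule ℤ D} {γ : D}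

/-- The quadratic `ℚ_q`-algebra `K_q = ℚ_q[X]/(X² - tX + n)` of `γ` (`t = trd γ`, `n = nrd γ`). -/
local notation "Kq" D ";" q ";" γ =>
  QuadraticAlgebra ℚ_[q] (-((reducedNorm ℚ D γ : ℚ) : ℚ_[q])) ((reducedTrace ℚ D γ : ℚ) : ℚ_[q])

/-- **The optimal order of `x O_(q)` at level `q`** is the set of rational points of
`mult(L) ∩ mult(L')`, `(L, L')` the transported pair `(ι⁻¹Λ_x, ι⁻¹Λ'_x)`. [cite: VignerasLNM800, Ch. II §3] -/
theorem ratCoords_mem_optimalOrder_smul_iff_level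
    (hO : ∀ y : D, y ∈ localAt q O ↔ (∀ i j, ‖Φ y i j‖ ≤ 1) ∧ ‖Φ y 1 0‖ ≤ (q : ℝ)⁻¹)
    (hO1 : (1 : D) ∈ O) (hOmul : ∀ a ∈ O, ∀ b ∈ O, a * b ∈ O)
    {v₀ : Fin 2 → ℚ_[q]} (hv₀ : vdet v₀ (Φ γ *ᵥ v₀) ≠ 0) (x : Dˣ) {α β α₂ β₂ : Kq D ; q ; γ}
    (hΛ : colLatt (Φ (x : D)) = iota v₀ (Φ γ *ᵥ v₀) '' latt α β)
    (hΛ₂ : colLatt (Φ (x : D) * diagQ q) = iota v₀ (Φ γ *ᵥ v₀) '' latt α₂ β₂) (r s : ℚ) :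
    algebraMap ℚ D r + s • γ ∈ optimalOrder (x • localAt q O) γ ↔
      (⟨(r : ℚ_[q]), (s : ℚ_[q])⟩ : Kq D ; q ; γ) ∈ mult α β ∧
        (⟨(r : ℚ_[q]), (s : ℚ_[q])⟩ : Kq D ; q ; γ) ∈ mult α₂ β₂ := by
  rw [mem_optimalOrder_iff, and_iff_left (ratCoords_mem_adjoin γ r s),
    mem_leftOrder_smul_localAt_iff_image_level Φ hO hO1 hOmul, hΛ, hΛ₂, map_ratCoords,
    image_mulVec_image_iota v₀ (Φ γ) (map_mul_self_eq Φ γ),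
    image_mulVec_image_iota v₀ (Φ γ) (map_mul_self_eq Φ γ),
    Set.image_subset_image_iff (iota_injective v₀ _ hv₀), Set.image_subset_image_iff (iota_injective v₀ _ hv₀),
    Set.image_subset_iff, Set.image_subset_iff, mem_mult_iff, mem_mult_iff]
  rfl

omit [IsQuaternionAlgebra ℚ D] in
/-- For `x ∈ Dˣ` the pair `(Λ_x, Λ'_x)` is `(ι[α, β], ι[α, qβ])` with `det(α, β) ≠ 0`. [folklore] -/
theorem exists_pair_eq_image_iota {v₀ : Fin 2 → ℚ_[q]} (hv₀ : vdet v₀ (Φ γ *ᵥ v₀) ≠ 0) (x : Dˣ) :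
    ∃ α β : Kq D ; q ; γ, α.re * β.im - β.re * α.im ≠ 0 ∧
      colLatt (Φ (x : D)) = iota v₀ (Φ γ *ᵥ v₀) '' latt α β ∧
        colLatt (Φ (x : D) * diagQ q) = iota v₀ (Φ γ *ᵥ v₀) '' latt α ((q : ℚ_[q]) • β) := by
  obtain ⟨α, hα⟩ := iota_surjective v₀ (Φ γ *ᵥ v₀) hv₀ (a := -((reducedNorm ℚ D γ : ℚ) : ℚ_[q]))
    (b := ((reducedTrace ℚ D γ : ℚ) : ℚ_[q])) ((Φ (x : D)).col 0)
  obtain ⟨β, hβ⟩ := iota_surjective v₀ (Φ γ *ᵥ v₀) hv₀ (a := -((reducedNorm ℚ D γ : ℚ) : ℚ_[q]))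
    (b := ((reducedTrace ℚ D γ : ℚ) : ℚ_[q])) ((Φ (x : D)).col 1)
  refine ⟨α, β, ?_, ?_, ?_⟩
  · have hdet := (isUnit_det_map_units Φ x).ne_zero
    rw [det_eq_vdet_col, ← hα, ← hβ, vdet_iota] at hdet
    exact left_ne_zero_of_mul hdet
  · rw [image_iota_latt, hα, hβ]
    rfl
  · rw [image_iota_latt, colLatt_mul_diagQ, iota_smul, hα, hβ]

omit [IsQuaternionAlgebra ℚ D] in
/-- **Density at level `q`**: every pair `(g ℤ_q², g D_q ℤ_q²)`, `g ∈ GL₂(ℚ_q)`, is `(Λ_b, Λ'_b)` for a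
global unit `b ∈ Dˣ` (approximate `g` within the Eichler unit group of level `q`). [cite: VignerasLNM800, Ch. III §5 Prop. 5.1 (proof)] -/
theorem exists_units_pair_eq [IsQuaternionAlgebra ℚ D] (hD : ∀ x : D, x ≠ 0 → IsUnit x)
    (g : Matrix (Fin 2) (Fin 2) ℚ_[q]) (hg : IsUnit g.det) :
    ∃ b : Dˣ, colLatt (Φ (b : D)) = colLatt g ∧ colLatt (Φ (b : D) * diagQ q) = colLatt (g * diagQ q) := by
  have hq0 : (0 : ℝ) < q := by exact_mod_cast hq.out.pos
  have hq0' : (q : ℚ_[q]) ≠ 0 := Nat.cast_ne_zero.mpr hq.out.ne_zero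
  obtain ⟨C, hC⟩ := Padic.exists_forall_norm_apply_le_pow g⁻¹
  obtain ⟨b₀, hb₀⟩ := AlgHom.exists_norm_sub_le Φ g (C + 2)
  set k : Matrix (Fin 2) (Fin 2) ℚ_[q] := g⁻¹ * Φ b₀ with hkdef
  have h1 : ∀ i j, ‖(1 : Matrix (Fin 2) (Fin 2) ℚ_[q]) i j‖ ≤ 1 := fun i j => by
    rw [Matrix.one_apply]; split_ifs <;> simp
  have hk1 : k - 1 = g⁻¹ * (Φ b₀ - g) * 1 := by
    rw [mul_one, mul_sub, Matrix.nonsing_inv_mul _ hg]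
  have hkn : ∀ i j, ‖(k - 1) i j‖ ≤ (q : ℝ) ^ (-((1 + 1 : ℕ) : ℤ)) := by
    intro i j
    rw [hk1]
    refine (Padic.norm_mul_mul_apply_le hC hb₀ h1 (pow_nonneg hq0.le _)
      (zpow_nonneg hq0.le _) i j).trans (le_of_eq ?_)
    rw [mul_one, ← zpow_natCast, ← zpow_add₀ hq0.ne']
    congr 1
    push_cast
    ring
  obtain ⟨hkE, hkE', hkdet⟩ := Padic.eichler_of_norm_sub_one_le hkn
  have hkdet' : IsUnit k.det := isUnit_iff_ne_zero.mpr fun h => by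
    rw [h, norm_zero] at hkdet; exact zero_ne_one hkdet
  have hΦb₀ : Φ b₀ = g * k := by rw [hkdef, Matrix.mul_nonsing_inv_cancel_left _ _ hg]
  have hb₀ : b₀ ≠ 0 := by
    intro h0
    apply hkdet'.ne_zero
    rw [hkdef, h0, map_zero, mul_zero, Matrix.det_zero]
  clear_value k
  set b : Dˣ := (hD b₀ hb₀).unit with hbdef
  have hb : (b : D) = b₀ := (hD b₀ hb₀).unit_spec
  -- `D_q⁻¹ k D_q` and `D_q⁻¹ k⁻¹ D_q` are integral
  have hd : ‖(q : ℚ_[q])‖ = (q : ℝ) ^ (-((1 : ℕ) : ℤ)) * ‖(1 : ℚ_[q])‖ := by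
    rw [norm_one, mul_one, Padic.norm_p]; simp
  have hkD : ∀ i j, ‖((diagQ q)⁻¹ * k * diagQ q) i j‖ ≤ 1 :=
    ((Padic.integral_and_diag_conj_integral_iff one_ne_zero hq0' hd k).mpr hkE).2
  have hkD' : ∀ i j, ‖((diagQ q)⁻¹ * k⁻¹ * diagQ q) i j‖ ≤ 1 :=
    ((Padic.integral_and_diag_conj_integral_iff one_ne_zero hq0' hd k⁻¹).mpr hkE').2
  refine ⟨b, ?_, ?_⟩
  · rw [hb, hΦb₀]
    refine colLatt_eq_of_integral hg (by rw [Matrix.det_mul]; exact hg.mul hkdet') ?_ ?_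
    · rw [Matrix.nonsing_inv_mul_cancel_left _ _ hg]; exact hkE.1
    · rw [Matrix.mul_inv_rev, mul_assoc, Matrix.nonsing_inv_mul _ hg, mul_one]; exact hkE'.1
  · rw [hb, hΦb₀]
    have hgD : IsUnit (g * diagQ q).det := by rw [Matrix.det_mul]; exact hg.mul isUnit_det_diagQ
    refine colLatt_eq_of_integral hgD (by rw [Matrix.det_mul, Matrix.det_mul]; exact (hg.mul hkdet').mul isUnit_det_diagQ) ?_ ?_
    · have : (g * diagQ q)⁻¹ * (g * k * diagQ q) = (diagQ q)⁻¹ * k * diagQ q := by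
        rw [Matrix.mul_inv_rev]
        simp only [mul_assoc]
        rw [Matrix.nonsing_inv_mul_cancel_left _ _ hg]
      rw [this]; exact hkD
    · have : (g * k * diagQ q)⁻¹ * (g * diagQ q) = (diagQ q)⁻¹ * k⁻¹ * diagQ q := by
        rw [Matrix.mul_inv_rev, Matrix.mul_inv_rev]
        simp only [mul_assoc]
        rw [Matrix.nonsing_inv_mul_cancel_left _ _ hg]
      rw [this]; exact hkD'

/-- `q^N [1, ω] ⊆ [α, β]` persists for larger exponents. [folklore] -/
theorem pow_smul_mem_latt_of_le {a b : ℚ_[q]} {α β : QuadraticAlgebra ℚ_[q] a b} {N : ℕ}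
    (hN : ∀ z ∈ latt (1 : QuadraticAlgebra ℚ_[q] a b) ⟨0, 1⟩, ((q : ℚ_[q]) ^ N) • z ∈ latt α β) {N' : ℕ}
    (hNN' : N ≤ N') {z : QuadraticAlgebra ℚ_[q] a b} (hz : z ∈ latt (1 : QuadraticAlgebra ℚ_[q] a b) ⟨0, 1⟩) :
    ((q : ℚ_[q]) ^ N') • z ∈ latt α β := by
  obtain ⟨d, rfl⟩ := Nat.exists_eq_add_of_le hNN'
  rw [pow_add, mul_smul]
  exact hN _ (smul_mem_latt (c := (q : ℚ_[q]) ^ d)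
    (by rw [norm_pow]; exact pow_le_one₀ (norm_nonneg _) norm_q_le_one) hz)

/-- **Transitivity at level `q`**: if the pairs of `x` and `x'` differ by a unit `μ` of `K_q` —
`(L_{x'}, L'_{x'}) = μ (L_x, L'_x)` — then `x' O_(q) = c x O_(q)` for a global `c ∈ ℚ(γ)ˣ`
(approximate `μ` by a rational point of `μ(1 + q(mult L_x ∩ mult L'_x))`). [cite: VignerasLNM800, Ch. II §3; Ch. III §5 Thm. 5.11] -/
theorem exists_eq_smul_of_pair_eq (hD : ∀ x : D, x ≠ 0 → IsUnit x)
    (hO : ∀ y : D, y ∈ localAt q O ↔ (∀ i j, ‖Φ y i j‖ ≤ 1) ∧ ‖Φ y 1 0‖ ≤ (q : ℝ)⁻¹)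
    {v₀ : Fin 2 → ℚ_[q]} (hv₀ : vdet v₀ (Φ γ *ᵥ v₀) ≠ 0) {x x' : Dˣ} {α β α₂ β₂ μ : Kq D ; q ; γ}
    (hdet : α.re * β.im - β.re * α.im ≠ 0) (hdet₂ : α₂.re * β₂.im - β₂.re * α₂.im ≠ 0) (hμ : IsUnit μ)
    (hΛ : colLatt (Φ (x : D)) = iota v₀ (Φ γ *ᵥ v₀) '' latt α β)
    (hΛ₂ : colLatt (Φ (x : D) * diagQ q) = iota v₀ (Φ γ *ᵥ v₀) '' latt α₂ β₂)
    (hΛ' : colLatt (Φ (x' : D)) = iota v₀ (Φ γ *ᵥ v₀) '' ((fun z => μ * z) '' latt α β))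
    (hΛ₂' : colLatt (Φ (x' : D) * diagQ q) = iota v₀ (Φ γ *ᵥ v₀) '' ((fun z => μ * z) '' latt α₂ β₂)) :
    ∃ c : Dˣ, (c : D) * γ = γ * c ∧ x' • localAt q O = c • (x • localAt q O) := by
  have hA := map_mul_self_eq Φ γ
  -- normal forms of the two lattices of `x`
  obtain ⟨lam, σ, hlam, hσ, hring, hl, -⟩ := exists_mult_eq_latt_one hdet
  obtain ⟨lam₂, σ₂, hlam₂, hσ₂, hring₂, hl₂, -⟩ := exists_mult_eq_latt_one hdet₂
  -- a common neighbourhood `q^N [1, ω] ⊆ μ[1, σ] ∩ μ[1, σ₂]`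
  have hdetμ : ∀ {τ : Kq D ; q ; γ}, τ.im ≠ 0 →
      (μ * 1).re * (μ * τ).im - (μ * τ).re * (μ * 1).im ≠ 0 := fun {τ} hτ => by
    rw [det_mul_mul]
    refine mul_ne_zero (isUnit_iff_norm_ne_zero.mp hμ) ?_
    change (1 : ℚ_[q]) * τ.im - τ.re * 0 ≠ 0
    simpa using hτ
  obtain ⟨N₁, hN₁⟩ := exists_pow_smul_latt_one_omega_subset (hdetμ hσ)
  obtain ⟨N₂, hN₂⟩ := exists_pow_smul_latt_one_omega_subset (hdetμ hσ₂)
  obtain ⟨r, s, y, hy, hrs⟩ := exists_rat_sub_mem μ (N₁ + N₂ + 1)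
  have hy₁ : ((q : ℚ_[q]) ^ (N₁ + N₂)) • y ∈ (fun z => μ * z) '' latt 1 σ := by
    rw [← latt_mul]; exact pow_smul_mem_latt_of_le hN₁ (Nat.le_add_right _ _) hy
  have hy₂ : ((q : ℚ_[q]) ^ (N₁ + N₂)) • y ∈ (fun z => μ * z) '' latt 1 σ₂ := by
    rw [← latt_mul]; exact pow_smul_mem_latt_of_le hN₂ (Nat.le_add_left _ _) hy
  obtain ⟨z₁, hz₁, hz₁eq⟩ := hy₁
  obtain ⟨z₂, hz₂, hz₂eq⟩ := hy₂
  obtain ⟨μu, rfl⟩ := hμ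
  have hz₁₂ : z₁ = z₂ := by
    have : (μu : Kq D ; q ; γ) * z₁ = μu * z₂ := hz₁eq.trans hz₂eq.symm
    simpa using congrArg (fun w => ((μu⁻¹ : (Kq D ; q ; γ)ˣ) : Kq D ; q ; γ) * w) this
  set κ : Kq D ; q ; γ := ⟨(r : ℚ_[q]), (s : ℚ_[q])⟩ with hκdef
  set w : Kq D ; q ; γ := 1 + (q : ℚ_[q]) • (-z₁) with hwdef
  have hκ : κ = μu * w := by
    have e : (μu : Kq D ; q ; γ) - κ = ((q : ℚ_[q]) ^ (N₁ + N₂ + 1)) • y := hrs.symm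
    rw [pow_succ, mul_comm, mul_smul, hz₁eq.symm] at e
    rw [hwdef, mul_add, mul_one, smul_neg, mul_neg, mul_smul_comm, ← e]
    abel
  obtain ⟨hwmem, w', hw', hww', -⟩ := exists_inverse_one_add_of_mem hσ hring (neg_mem_latt hz₁)
  obtain ⟨hwmem₂, w₂', hw₂', hww₂', -⟩ := exists_inverse_one_add_of_mem hσ₂ hring₂ (neg_mem_latt (hz₁₂ ▸ hz₂))
  have hκimg : ∀ {α β lam σ : Kq D ; q ; γ} {w' : Kq D ; q ; γ}, σ * σ ∈ latt 1 σ →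
      latt α β = (fun z => lam * z) '' latt 1 σ → w ∈ latt 1 σ → w' ∈ latt 1 σ → w * w' = 1 →
      (fun z => κ * z) '' latt α β = (fun z => (μu : Kq D ; q ; γ) * z) '' latt α β := by
    intro α β lam σ w' hring hl hwmem hw' hww'
    rw [hl, hκ]
    conv_rhs => rw [← image_mul_eq_of_unit (lam := lam) hring hwmem hw' hww']
    simp only [Set.image_image]
    refine Set.image_congr fun z _ => ?_
    ring
  have hκ₁ := hκimg hring hl hwmem hw' hww'
  have hκ₂ := hκimg hring₂ hl₂ hwmem₂ hw₂' hww₂'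
  -- the global element `c = r + sγ`
  set c : D := algebraMap ℚ D r + s • γ with hcdef
  have hΦc : Φ c = QuadraticAlgebra.lift ⟨Φ γ, hA⟩ κ := map_ratCoords Φ r s
  have hκ0 : κ ≠ 0 := by
    rw [hκ]
    exact (μu.isUnit.mul (IsUnit.of_mul_eq_one w' hww')).ne_zero
  have hc0 : c ≠ 0 := by
    intro h0
    apply hκ0
    apply lift_injective Φ hv₀
    rw [← hΦc, h0, map_zero, map_zero]
  set cu : Dˣ := (hD c hc0).unit with hcudef
  have hcu : (cu : D) = c := (hD c hc0).unit_spec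
  refine ⟨cu, by rw [hcu]; exact ratCoords_comm γ r s, ?_⟩
  rw [← mul_smul]
  refine (smul_localAt_eq_of_colLatt_eq_level Φ hO ?_ ?_).symm
  · rw [Units.val_mul, hcu, map_mul, colLatt_mul, hΛ, hΦc, image_mulVec_image_iota v₀ (Φ γ) hA, hκ₁, hΛ']
  · rw [Units.val_mul, hcu, map_mul, mul_assoc, colLatt_mul, hΛ₂, hΦc, image_mulVec_image_iota v₀ (Φ γ) hA,
      hκ₂, hΛ₂']

omit [IsQuaternionAlgebra ℚ D] in
/-- `Λ(ofCols (ι z) (ι w)) = ι [z, w]`. [folklore] -/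
theorem colLatt_ofCols_iota (v₀ : Fin 2 → ℚ_[q]) (z w : Kq D ; q ; γ) :
    colLatt (ofCols (iota v₀ (Φ γ *ᵥ v₀) z) (iota v₀ (Φ γ *ᵥ v₀) w)) = iota v₀ (Φ γ *ᵥ v₀) '' latt z w := by
  rw [image_iota_latt, colLatt, ofCols_col_zero, ofCols_col_one]

omit [IsQuaternionAlgebra ℚ D] in
/-- `Λ(ofCols (ι z) (ι w) D_q) = ι [z, q w]`. [folklore] -/
theorem colLatt_ofCols_iota_mul_diagQ (v₀ : Fin 2 → ℚ_[q]) (z w : Kq D ; q ; γ) :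
    colLatt (ofCols (iota v₀ (Φ γ *ᵥ v₀) z) (iota v₀ (Φ γ *ᵥ v₀) w) * diagQ q) =
      iota v₀ (Φ γ *ᵥ v₀) '' latt z ((q : ℚ_[q]) • w) := by
  rw [image_iota_latt, colLatt_mul_diagQ, ofCols_col_zero, ofCols_col_one, iota_smul]

omit [IsQuaternionAlgebra ℚ D] in
/-- `ofCols (ι z) (ι w)` is invertible when `det(z, w) ≠ 0`. [folklore] -/
theorem isUnit_det_ofCols_iota {v₀ : Fin 2 → ℚ_[q]} (hv₀ : vdet v₀ (Φ γ *ᵥ v₀) ≠ 0) {z w : Kq D ; q ; γ}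
    (h : z.re * w.im - w.re * z.im ≠ 0) :
    IsUnit (ofCols (iota v₀ (Φ γ *ᵥ v₀) z) (iota v₀ (Φ γ *ᵥ v₀) w)).det := by
  rw [isUnit_iff_ne_zero, det_eq_vdet_col, ofCols_col_zero, ofCols_col_one, vdet_iota]
  exact mul_ne_zero h hv₀

end LevelOptimal

/-! ### The count: representatives of the classes and `m_q(B) = ρ_q(B) + [B_q not maximal]` -/

section LevelCount

variable {D : Type u} [Ring D] [Algebra ℚ D] [IsQuaternionAlgebra ℚ D] {q : ℕ} [hq : Fact q.Prime]
  {Φ : D →ₐ[ℚ] Matrix (Fin 2) (Fin 2) ℚ_[q]} {O : Submodule ℤ D} {γ : D} {B : Submodule ℤ D}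
  {σ₀ : D} {r₀ : ℚ} {m : ℕ} {tB nB : ℤ}

/-- The quadratic `ℚ_q`-algebra `K_q = ℚ_q[X]/(X² - tX + n)` of `γ` (`t = trd γ`, `n = nrd γ`). -/
local notation "Kq" D ";" q ";" γ =>
  QuadraticAlgebra ℚ_[q] (-((reducedNorm ℚ D γ : ℚ) : ℚ_[q])) ((reducedTrace ℚ D γ : ℚ) : ℚ_[q])

/-- The generator `σ_q = r₀ + ω/m` of the completed order `B_q = [1, σ_q]` (notation). -/
local notation "σq" => (QuadraticAlgebra.mk (r₀ : ℚ_[q]) (((m : ℚ)⁻¹ : ℚ) : ℚ_[q]) : Kq D ; q ; γ)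

/-- The generator `σ' = (σ_q + k₀)/q` of the over-ring `R'`, `ℤ_q + qR' = B_q` (notation). -/
local notation "σ'[" k "]" => ((q : ℚ_[q])⁻¹ • (σq + ((k : ℤ) : ℚ_[q]) • (1 : Kq D ; q ; γ)))

omit [IsQuaternionAlgebra ℚ D] in
/-- `qσ' = σ_q + k₀`. [folklore] -/
theorem smul_σ' (k₀ : ℤ) : (q : ℚ_[q]) • σ'[k₀] = σq + (k₀ : ℚ_[q]) • 1 := by
  rw [smul_smul, mul_inv_cancel₀ (Nat.cast_ne_zero.mpr hq.out.ne_zero), one_smul]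

omit [IsQuaternionAlgebra ℚ D] in
/-- `[1, qσ'] = [1, σ_q]`. [folklore] -/
theorem latt_one_smul_σ' (k₀ : ℤ) : latt 1 ((q : ℚ_[q]) • σ'[k₀]) = latt 1 σq := by
  rw [smul_σ']; exact latt_one_add_smul_one _ (Padic.norm_int_le_one _)

/-- **Hypotheses of the local count at level `q`**, bundled: a division quaternion algebra `D`,
`γ ∉ ℚ`, a level-`q` matrix model `Φ` of the order `O` (`O_(q) = Φ⁻¹(ℤ_q ℤ_q; qℤ_q ℤ_q)`), and an
order `B ∋ γ` of `ℚ(γ)` with `ℤ`-basis `(1, σ₀)`, `σ₀ = r₀ + γ/m`, `σ₀² = t_B σ₀ - n_B`. [cite: VignerasLNM800, Ch. II §3] -/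
structure LevelHyp (Φ : D →ₐ[ℚ] Matrix (Fin 2) (Fin 2) ℚ_[q]) (O : Submodule ℤ D) (γ : D)
    (B : Submodule ℤ D) (σ₀ : D) (r₀ : ℚ) (m : ℕ) (tB nB : ℤ) : Prop where
  hD : ∀ x : D, x ≠ 0 → IsUnit x
  hγ : γ ∉ (⊥ : Subalgebra ℚ D)
  hO : ∀ y : D, y ∈ localAt q O ↔ (∀ i j, ‖Φ y i j‖ ≤ 1) ∧ ‖Φ y 1 0‖ ≤ (q : ℝ)⁻¹
  hO1 : (1 : D) ∈ O
  hOmul : ∀ a ∈ O, ∀ b ∈ O, a * b ∈ O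
  hB : IsQuadOrder γ B
  hm : m ≠ 0
  hσ₀ : σ₀ = algebraMap ℚ D r₀ + (m : ℚ)⁻¹ • γ
  hBσ : ∀ b : D, b ∈ B ↔ ∃ u v : ℤ, b = algebraMap ℚ D u + v • σ₀
  hsq : σ₀ * σ₀ = (tB : ℚ) • σ₀ - algebraMap ℚ D nB

namespace LevelHyp

variable (H : LevelHyp Φ O γ B σ₀ r₀ m tB nB)
include H

/-- A cyclic vector of `Φ(γ)`. [folklore] -/
theorem exists_v₀ : ∃ v₀ : Fin 2 → ℚ_[q], vdet v₀ (Φ γ *ᵥ v₀) ≠ 0 :=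
  exists_vdet_mulVec_ne_zero (map_ne_smul_one Φ H.hD H.hγ)

/-- A chosen cyclic vector. [folklore] -/
def v₀ : Fin 2 → ℚ_[q] := H.exists_v₀.choose

/-- The chosen vector is cyclic. [folklore] -/
theorem hv₀ : vdet H.v₀ (Φ γ *ᵥ H.v₀) ≠ 0 := H.exists_v₀.choose_spec

omit [IsQuaternionAlgebra ℚ D] in
/-- `σ_q.im = 1/m ≠ 0`: `σ_q ∉ ℚ_q`. [folklore] -/
theorem σq_im_ne : (σq).im ≠ 0 := by
  show (((m : ℚ)⁻¹ : ℚ) : ℚ_[q]) ≠ 0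
  push_cast
  exact inv_ne_zero (Nat.cast_ne_zero.mpr H.hm)

omit [IsQuaternionAlgebra ℚ D] in
/-- `σ_q.im = 1/m`. [folklore] -/
theorem σq_im : (σq).im = ((m : ℚ_[q]))⁻¹ := by
  have := H.hm
  show (((m : ℚ)⁻¹ : ℚ) : ℚ_[q]) = _
  push_cast
  rfl

/-- `Φ(σ₀) = ψ(σ_q)`. [folklore] -/
theorem map_σ₀ : Φ σ₀ = QuadraticAlgebra.lift ⟨Φ γ, map_mul_self_eq Φ γ⟩ σq := by
  rw [H.hσ₀]; exact map_ratCoords Φ r₀ (m : ℚ)⁻¹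

/-- `Φ(u + vσ₀) = ψ(u + vσ_q)`. [folklore] -/
theorem map_ratCoords_σ₀ (u v : ℚ) :
    Φ (algebraMap ℚ D u + v • σ₀) =
      QuadraticAlgebra.lift ⟨Φ γ, map_mul_self_eq Φ γ⟩ ((u : ℚ_[q]) • 1 + (v : ℚ_[q]) • σq) := by
  rw [map_add, map_smul, AlgHom.commutes, H.map_σ₀, map_add, map_smul, map_smul, map_one,
    Algebra.algebraMap_eq_smul_one, ← algebraMap_smul ℚ_[q] u,
    ← algebraMap_smul ℚ_[q] v (QuadraticAlgebra.lift ⟨Φ γ, map_mul_self_eq Φ γ⟩ σq), eq_ratCast, eq_ratCast]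

/-- **`tr σ_q = t_B` and `N(σ_q) = n_B`** (from `σ₀² = t_B σ₀ - n_B`). [folklore] -/
theorem tr_σq_and_norm_σq : tr σq = (tB : ℚ_[q]) ∧ (σq).norm = (nB : ℚ_[q]) := by
  have key : σq * σq = ((-(nB : ℚ) : ℚ) : ℚ_[q]) • (1 : Kq D ; q ; γ) + (((tB : ℤ) : ℚ) : ℚ_[q]) • σq := by
    apply lift_injective Φ H.hv₀
    rw [map_mul, ← H.map_σ₀, ← map_mul, H.hsq, ← H.map_ratCoords_σ₀ (-(nB : ℚ)) tB]
    congr 1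
    rw [map_neg, sub_eq_add_neg, add_comm]
  rw [mul_self_eq, Algebra.algebraMap_eq_smul_one, sub_eq_add_neg, ← neg_smul, add_comm] at key
  obtain ⟨h1, h2⟩ := smul_one_add_smul_inj H.σq_im_ne key
  refine ⟨by rw [h2]; push_cast; rfl, ?_⟩
  rw [← neg_neg (QuadraticAlgebra.norm _), h1]
  push_cast
  ring

/-- `tr σ_q = t_B`. [folklore] -/
theorem tr_σq : tr σq = (tB : ℚ_[q]) := H.tr_σq_and_norm_σq.1

/-- `N σ_q = n_B`. [folklore] -/
theorem norm_σq : (σq).norm = (nB : ℚ_[q]) := H.tr_σq_and_norm_σq.2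

/-- `[1, σ_q]` is a ring lattice. [folklore] -/
theorem ring_σq : σq * σq ∈ latt 1 σq := by
  rw [mul_self_mem_latt_one_iff H.σq_im_ne, H.tr_σq, H.norm_σq]
  exact ⟨Padic.norm_int_le_one _, Padic.norm_int_le_one _⟩

/-- **The rational points of `[1, σ_q]` are `B_(q)`**: `r + sω ∈ [1, σ_q] ↔ r + sγ ∈ B_(q)`. [folklore] -/
theorem ratCoords_mem_latt_one_iff (r s : ℚ) :
    (⟨(r : ℚ_[q]), (s : ℚ_[q])⟩ : Kq D ; q ; γ) ∈ latt 1 σq ↔ algebraMap ℚ D r + s • γ ∈ localAt q B := by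
  have hcop : ∀ w : ℚ, w.den.Coprime q ↔ ‖(w : ℚ_[q])‖ ≤ 1 := fun w => by
    rw [Padic.norm_ratCast_le_one_iff, Nat.coprime_comm, Nat.Prime.coprime_iff_not_dvd hq.out]
  have hmq : (m : ℚ_[q]) ≠ 0 := Nat.cast_ne_zero.mpr H.hm
  have hmQ : (m : ℚ) ≠ 0 := Nat.cast_ne_zero.mpr H.hm
  rw [IsQuadOrder.mem_localAt_iff_of_monogenic H.hBσ]
  constructor
  · rintro ⟨u, w, hu, hw, huw⟩
    have hre := congrArg QuadraticAlgebra.re huw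
    have him := congrArg QuadraticAlgebra.im huw
    simp only [QuadraticAlgebra.re_add, QuadraticAlgebra.im_add, QuadraticAlgebra.re_smul,
      QuadraticAlgebra.im_smul, smul_eq_mul] at hre him
    change (r : ℚ_[q]) = u * 1 + w * r₀ at hre
    change (s : ℚ_[q]) = u * 0 + w * (((m : ℚ)⁻¹ : ℚ) : ℚ_[q]) at him
    rw [show ((((m : ℚ)⁻¹ : ℚ)) : ℚ_[q]) = ((m : ℚ_[q]))⁻¹ from H.σq_im] at him
    have hw' : w = ((s * m : ℚ) : ℚ_[q]) := by
      push_cast; rw [him]; field_simp; ring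
    have hu' : u = ((r - s * m * r₀ : ℚ) : ℚ_[q]) := by
      push_cast; rw [hre, hw']; push_cast; ring
    refine ⟨r - s * m * r₀, s * m, ?_, ?_, ?_⟩
    · rw [hcop, ← hu']; exact hu
    · rw [hcop, ← hw']; exact hw
    · rw [H.hσ₀, ratCoords_monogenic]
      congr 2
      · ring
      · field_simp
  · rintro ⟨u, v, hu, hv, huv⟩
    have e := (huv.trans (H.hσ₀ ▸ ratCoords_monogenic γ r₀ m u v))
    obtain ⟨h1, h2⟩ := rat_coords_unique H.hγ e
    refine ⟨u, v, (hcop u).mp hu, (hcop v).mp hv, ?_⟩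
    ext
    · simp [QuadraticAlgebra.re_one, h1]
    · rw [show ((⟨(r : ℚ_[q]), (s : ℚ_[q])⟩ : Kq D ; q ; γ)).im = (s : ℚ_[q]) from rfl]
      simp only [QuadraticAlgebra.im_add, QuadraticAlgebra.im_smul, QuadraticAlgebra.im_one, smul_eq_mul,
        mul_zero, zero_add, h2]
      push_cast
      rfl

/-- **Criterion for the optimal order**: `O_L(x O_(q)) ∩ ℚ(γ) = B_(q)` iff the rational points of
`mult(L_x) ∩ mult(L'_x)` are those of `[1, σ_q]`. [cite: VignerasLNM800, Ch. II §3] -/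
theorem optimalOrder_eq_iff (x : Dˣ) {α β α₂ β₂ : Kq D ; q ; γ}
    (hΛ : colLatt (Φ (x : D)) = iota H.v₀ (Φ γ *ᵥ H.v₀) '' latt α β)
    (hΛ₂ : colLatt (Φ (x : D) * diagQ q) = iota H.v₀ (Φ γ *ᵥ H.v₀) '' latt α₂ β₂) :
    optimalOrder (x • localAt q O) γ = localAt q B ↔
      ∀ r s : ℚ, ((⟨(r : ℚ_[q]), (s : ℚ_[q])⟩ : Kq D ; q ; γ) ∈ mult α β ∧
        (⟨(r : ℚ_[q]), (s : ℚ_[q])⟩ : Kq D ; q ; γ) ∈ mult α₂ β₂) ↔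
          (⟨(r : ℚ_[q]), (s : ℚ_[q])⟩ : Kq D ; q ; γ) ∈ latt 1 σq := by
  constructor
  · intro h r s
    rw [← ratCoords_mem_optimalOrder_smul_iff_level Φ H.hO H.hO1 H.hOmul H.hv₀ x hΛ hΛ₂, h,
      H.ratCoords_mem_latt_one_iff]
  · intro h
    ext y
    constructor
    · intro hy
      obtain ⟨r, s, rfl⟩ := exists_rat_eq_of_mem_adjoin H.hD H.hγ (mem_optimalOrder_iff.mp hy).2
      rw [← H.ratCoords_mem_latt_one_iff, ← h r s]
      exact (ratCoords_mem_optimalOrder_smul_iff_level Φ H.hO H.hO1 H.hOmul H.hv₀ x hΛ hΛ₂ r s).mp hy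
    · intro hy
      obtain ⟨r, s, rfl⟩ := exists_rat_eq_of_mem_adjoin H.hD H.hγ (H.hB.localAt_le_adjoin q hy)
      rw [ratCoords_mem_optimalOrder_smul_iff_level Φ H.hO H.hO1 H.hOmul H.hv₀ x hΛ hΛ₂, h r s]
      exact (H.ratCoords_mem_latt_one_iff r s).mpr hy

/-! #### Integer form of the local data -/

/-- `N(σ_q + k) = k² + t_B k + n_B` for an integer `k`. [folklore] -/
theorem norm_σq_add_intCast (k : ℤ) :
    (σq + (k : ℚ_[q]) • 1).norm = ((k ^ 2 + tB * k + nB : ℤ) : ℚ_[q]) := by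
  rw [norm_add_smul_one, H.tr_σq, H.norm_σq]; push_cast; ring

/-- `tr(σ_q + k) = t_B + 2k` for an integer `k`. [folklore] -/
theorem tr_σq_add_intCast (k : ℤ) : tr (σq + (k : ℚ_[q]) • 1) = ((tB + 2 * k : ℤ) : ℚ_[q]) := by
  rw [tr_add_smul_one, H.tr_σq]; push_cast; ring

/-- **`q ∣ N(σ_q + k) ↔ q ∣ k² + t_B k + n_B`.** [folklore] -/
theorem norm_lt_one_iff_dvd (k : ℕ) :
    ‖(σq + (k : ℚ_[q]) • 1).norm‖ < 1 ↔ (q : ℤ) ∣ (k : ℤ) ^ 2 + tB * k + nB := by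
  rw [show ((k : ℚ_[q])) = ((k : ℤ) : ℚ_[q]) by simp, H.norm_σq_add_intCast, Padic.norm_intCast_lt_one_iff]

/-- Shifting by a `q`-adically small amount keeps `q ∣ N`. [folklore] -/
theorem norm_norm_add_lt_one_of_sub {k k' : ℚ_[q]} (hk : ‖k‖ ≤ 1) (hk' : ‖k'‖ ≤ 1)
    (hN : ‖(σq + k • 1).norm‖ < 1) (hkk' : ‖k - k'‖ < 1) : ‖(σq + k' • 1).norm‖ < 1 := by
  have ht : ‖tr σq‖ ≤ 1 := by rw [H.tr_σq]; exact Padic.norm_int_le_one _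
  have e : (σq + k' • 1).norm = (σq + k • 1).norm + (k' - k) * (tr σq + k + k') := by
    rw [norm_add_smul_one, norm_add_smul_one]; ring
  rw [e]
  refine lt_of_le_of_lt (Padic.nonarchimedean _ _) (max_lt hN ?_)
  rw [norm_mul, ← norm_neg, neg_sub]
  refine mul_lt_one_of_nonneg_of_lt_one_left (norm_nonneg _) hkk' ?_
  exact (Padic.nonarchimedean _ _).trans (max_le ((Padic.nonarchimedean _ _).trans (max_le ht hk)) hk')

/-- **From `q`-adic to integral non-maximality**: if `tr(σ_q + k) ∈ q ℤ_q` and `N(σ_q + k) ∈ q² ℤ_q`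
for some `k ∈ ℤ_q`, then the same holds for an integer `k`. [folklore] -/
theorem exists_int_of_padic_nonmax {k : ℚ_[q]} (hk : ‖k‖ ≤ 1) (htr : ‖tr (σq + k • 1)‖ ≤ (q : ℝ)⁻¹)
    (hN : ‖(σq + k • 1).norm‖ ≤ ((q : ℝ) ^ 2)⁻¹) :
    ∃ k₁ : ℤ, (q : ℤ) ∣ tB + 2 * k₁ ∧ (q : ℤ) ^ 2 ∣ k₁ ^ 2 + tB * k₁ + nB := by
  have hq1 : (1 : ℝ) ≤ q := by exact_mod_cast hq.out.one_lt.le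
  have hq0 : (0 : ℝ) < q := by exact_mod_cast hq.out.pos
  have hpow2 : (q : ℝ) ^ (-((2 : ℕ) : ℤ)) = ((q : ℝ) ^ 2)⁻¹ := by rw [zpow_neg, zpow_natCast]
  have hpow1 : (q : ℝ) ^ (-((1 : ℕ) : ℤ)) = (q : ℝ)⁻¹ := by rw [zpow_neg, Nat.cast_one, zpow_one]
  obtain ⟨n₁, -, hn₁⟩ := exists_nat_norm_sub_le hk 2
  rw [hpow2] at hn₁
  have hn₁' : ‖(n₁ : ℚ_[q]) - k‖ ≤ ((q : ℝ) ^ 2)⁻¹ := by rwa [← norm_neg, neg_sub]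
  have hq2 : ((q : ℝ) ^ 2)⁻¹ ≤ (q : ℝ)⁻¹ := by
    rw [inv_le_inv₀ (pow_pos hq0 2) hq0]
    exact le_self_pow₀ hq1 two_ne_zero
  refine ⟨n₁, ?_, ?_⟩
  · have e : tr (σq + ((n₁ : ℤ) : ℚ_[q]) • 1) = tr (σq + k • 1) + 2 * ((n₁ : ℚ_[q]) - k) := by
      rw [tr_add_smul_one, tr_add_smul_one]; push_cast; ring
    have h : ‖tr (σq + ((n₁ : ℤ) : ℚ_[q]) • 1)‖ ≤ (q : ℝ) ^ (-((1 : ℕ) : ℤ)) := by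
      rw [hpow1, e]
      refine (Padic.nonarchimedean _ _).trans (max_le htr ?_)
      rw [norm_mul]
      calc ‖(2 : ℚ_[q])‖ * ‖(n₁ : ℚ_[q]) - k‖ ≤ 1 * (q : ℝ)⁻¹ :=
            mul_le_mul norm_two_le_one (hn₁'.trans hq2) (norm_nonneg _) zero_le_one
        _ = (q : ℝ)⁻¹ := one_mul _
    rw [H.tr_σq_add_intCast, Padic.norm_int_le_pow_iff_dvd, pow_one] at h
    exact h
  · have e : (σq + ((n₁ : ℤ) : ℚ_[q]) • 1).norm =
        (σq + k • 1).norm + ((n₁ : ℚ_[q]) - k) * (tr (σq + k • 1) + ((n₁ : ℚ_[q]) - k)) := by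
      rw [norm_add_smul_one, norm_add_smul_one, tr_add_smul_one]; push_cast; ring
    have htr1 : ‖tr (σq + k • 1) + ((n₁ : ℚ_[q]) - k)‖ ≤ 1 :=
      (Padic.nonarchimedean _ _).trans (max_le (htr.trans (inv_le_one_of_one_le₀ hq1))
        (hn₁'.trans ((inv_le_one_of_one_le₀ (one_le_pow₀ hq1)))))
    have h : ‖(σq + ((n₁ : ℤ) : ℚ_[q]) • 1).norm‖ ≤ (q : ℝ) ^ (-((2 : ℕ) : ℤ)) := by
      rw [hpow2, e]
      refine (Padic.nonarchimedean _ _).trans (max_le hN ?_)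
      rw [norm_mul]
      calc ‖(n₁ : ℚ_[q]) - k‖ * ‖tr (σq + k • 1) + ((n₁ : ℚ_[q]) - k)‖ ≤ ((q : ℝ) ^ 2)⁻¹ * 1 :=
            mul_le_mul hn₁' htr1 (norm_nonneg _) (by positivity)
        _ = ((q : ℝ) ^ 2)⁻¹ := mul_one _
    rw [H.norm_σq_add_intCast, Padic.norm_int_le_pow_iff_dvd] at h
    exact h

/-- **Non-maximality from an over-ring**: if `[1, qσ₁] = [1, σ_q]` for a ring generator `σ₁` then
`B_q` is not maximal in the integer sense. [folklore] -/
theorem exists_int_of_latt_one_smul_eq {σ₁ : Kq D ; q ; γ} (hσ₁ : σ₁.im ≠ 0) (hring₁ : σ₁ * σ₁ ∈ latt 1 σ₁)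
    (h : latt 1 ((q : ℚ_[q]) • σ₁) = latt 1 σq) :
    ∃ k₁ : ℤ, (q : ℤ) ∣ tB + 2 * k₁ ∧ (q : ℤ) ^ 2 ∣ k₁ ^ 2 + tB * k₁ + nB := by
  have hq0 : (0 : ℝ) < q := by exact_mod_cast hq.out.pos
  obtain ⟨ht₁, hN₁⟩ := (mul_self_mem_latt_one_iff hσ₁).mp hring₁
  obtain ⟨u, v, hu, hv, he⟩ : σq ∈ latt 1 ((q : ℚ_[q]) • σ₁) := h.symm ▸ right_mem_latt 1 σq
  have hk : σq + (-u) • 1 = (v * q) • σ₁ := by rw [he, smul_smul, neg_smul]; abel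
  refine H.exists_int_of_padic_nonmax (k := -u) (by rw [norm_neg]; exact hu) ?_ ?_
  · rw [hk]
    have : tr ((v * q) • σ₁) = (v * q) * tr σ₁ := by simp [tr]; ring
    rw [this, norm_mul, norm_mul, Padic.norm_p]
    calc ‖v‖ * (q : ℝ)⁻¹ * ‖tr σ₁‖ ≤ 1 * (q : ℝ)⁻¹ * 1 := by gcongr
      _ = (q : ℝ)⁻¹ := by ring
  · rw [hk]
    have : ((v * q) • σ₁).norm = (v * q) ^ 2 * σ₁.norm := by simp [QuadraticAlgebra.norm_def]; ring
    rw [this, norm_mul, norm_pow, norm_mul, Padic.norm_p]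
    calc (‖v‖ * (q : ℝ)⁻¹) ^ 2 * ‖σ₁.norm‖ ≤ (1 * (q : ℝ)⁻¹) ^ 2 * 1 := by gcongr
      _ = ((q : ℝ) ^ 2)⁻¹ := by rw [one_mul, mul_one, inv_pow]

/-! #### The over-ring `R' = [1, σ']`, `σ' = (σ_q + k₀)/q` -/

omit [IsQuaternionAlgebra ℚ D] in
/-- `σ'.im ≠ 0`. [folklore] -/
theorem σ'_im_ne (k₀ : ℤ) : (σ'[k₀]).im ≠ 0 := by
  rw [im_smul', im_add_smul_one]
  exact mul_ne_zero (inv_ne_zero (Nat.cast_ne_zero.mpr hq.out.ne_zero)) H.σq_im_ne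

/-- **`σ'` is a ring generator** when `k₀` witnesses non-maximality. [folklore] -/
theorem ring_σ' {k₀ : ℤ} (h1 : (q : ℤ) ∣ tB + 2 * k₀) (h2 : (q : ℤ) ^ 2 ∣ k₀ ^ 2 + tB * k₀ + nB) :
    σ'[k₀] * σ'[k₀] ∈ latt 1 (σ'[k₀]) := by
  have hq0 : (q : ℚ_[q]) ≠ 0 := Nat.cast_ne_zero.mpr hq.out.ne_zero
  have hqr : (0 : ℝ) < q := by exact_mod_cast hq.out.pos
  rw [mul_self_mem_latt_one_iff (H.σ'_im_ne k₀)]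
  have htr : tr σ'[k₀] = (q : ℚ_[q])⁻¹ * tr (σq + (k₀ : ℚ_[q]) • 1) := by
    simp [tr]; ring
  have hN : (σ'[k₀]).norm = ((q : ℚ_[q])⁻¹) ^ 2 * (σq + (k₀ : ℚ_[q]) • 1).norm := by
    simp [QuadraticAlgebra.norm_def]; ring
  have h1' : ‖tr (σq + (k₀ : ℚ_[q]) • 1)‖ ≤ (q : ℝ) ^ (-(1 : ℕ) : ℤ) := by
    rw [H.tr_σq_add_intCast, Padic.norm_int_le_pow_iff_dvd, pow_one]; exact h1
  have h2' : ‖(σq + (k₀ : ℚ_[q]) • 1).norm‖ ≤ (q : ℝ) ^ (-(2 : ℕ) : ℤ) := by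
    rw [H.norm_σq_add_intCast, Padic.norm_int_le_pow_iff_dvd]; exact_mod_cast h2
  constructor
  · rw [htr, norm_mul, norm_inv, Padic.norm_p, inv_inv]
    calc (q : ℝ) * ‖tr (σq + (k₀ : ℚ_[q]) • 1)‖ ≤ q * (q : ℝ) ^ (-(1 : ℕ) : ℤ) := by gcongr
      _ = 1 := by rw [show (-(1 : ℕ) : ℤ) = -1 by norm_num, zpow_neg, zpow_one, mul_inv_cancel₀ hqr.ne']
  · rw [hN, norm_mul, norm_pow, norm_inv, Padic.norm_p, inv_inv]
    calc (q : ℝ) ^ 2 * ‖(σq + (k₀ : ℚ_[q]) • 1).norm‖ ≤ (q : ℝ) ^ 2 * (q : ℝ) ^ (-(2 : ℕ) : ℤ) := by gcongr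
      _ = 1 := by rw [show (-(2 : ℕ) : ℤ) = -2 by norm_num, zpow_neg, zpow_ofNat, mul_inv_cancel₀ (pow_ne_zero 2 hqr.ne')]

/-! #### Optimality in terms of the local invariant -/

/-- If `mult(L) ∩ mult(L') = [1, τ]` then `x O_(q)` has optimal order `B_(q)` iff `[1, τ] = [1, σ_q]`
(rational points are dense). [folklore] -/
theorem optimalOrder_eq_iff_of_inter_eq (x : Dˣ) {α β α₂ β₂ τ : Kq D ; q ; γ} (hτ : τ.im ≠ 0)
    (hΛ : colLatt (Φ (x : D)) = iota H.v₀ (Φ γ *ᵥ H.v₀) '' latt α β)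
    (hΛ₂ : colLatt (Φ (x : D) * diagQ q) = iota H.v₀ (Φ γ *ᵥ H.v₀) '' latt α₂ β₂)
    (hint : mult α β ∩ mult α₂ β₂ = latt 1 τ) :
    optimalOrder (x • localAt q O) γ = localAt q B ↔ latt 1 τ = latt 1 σq := by
  rw [H.optimalOrder_eq_iff x hΛ hΛ₂]
  constructor
  · intro h
    apply latt_one_eq_of_forall_rat hτ H.σq_im_ne
    intro r s
    rw [← h r s, ← Set.mem_inter_iff, hint]
  · intro h r s
    rw [← Set.mem_inter_iff, hint, h]

/-- The same with the data given up to a unit `λ`. [folklore] -/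
theorem optimalOrder_eq_iff_of_inter_eq' (x : Dˣ) {lam : (Kq D ; q ; γ)ˣ} {α β α₂ β₂ τ : Kq D ; q ; γ}
    (hτ : τ.im ≠ 0)
    (hΛ : colLatt (Φ (x : D)) = iota H.v₀ (Φ γ *ᵥ H.v₀) '' ((fun z => (lam : Kq D ; q ; γ) * z) '' latt α β))
    (hΛ₂ : colLatt (Φ (x : D) * diagQ q) =
      iota H.v₀ (Φ γ *ᵥ H.v₀) '' ((fun z => (lam : Kq D ; q ; γ) * z) '' latt α₂ β₂))
    (hint : mult α β ∩ mult α₂ β₂ = latt 1 τ) :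
    optimalOrder (x • localAt q O) γ = localAt q B ↔ latt 1 τ = latt 1 σq := by
  rw [← latt_mul] at hΛ hΛ₂
  apply H.optimalOrder_eq_iff_of_inter_eq x hτ hΛ hΛ₂
  rw [mult_mul_of_isUnit lam.isUnit, mult_mul_of_isUnit lam.isUnit, hint]

/-! #### Normal form of the data of a local ideal -/

/-- **Normal form of `(Λ_x, Λ'_x)`**: `Λ_x = ι λ[α', β']`, `Λ'_x = ι λ[α', qβ']` with `λ` a unit and
`[α', β'] = [1, σ₁]` a ring lattice. [folklore] -/
theorem exists_unit_pair (x : Dˣ) : ∃ lam : (Kq D ; q ; γ)ˣ, ∃ α' β' σ₁ : Kq D ; q ; γ,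
    σ₁.im ≠ 0 ∧ σ₁ * σ₁ ∈ latt 1 σ₁ ∧ latt α' β' = latt 1 σ₁ ∧
      colLatt (Φ (x : D)) = iota H.v₀ (Φ γ *ᵥ H.v₀) '' ((fun z => (lam : Kq D ; q ; γ) * z) '' latt α' β') ∧
        colLatt (Φ (x : D) * diagQ q) =
          iota H.v₀ (Φ γ *ᵥ H.v₀) '' ((fun z => (lam : Kq D ; q ; γ) * z) '' latt α' ((q : ℚ_[q]) • β')) := by
  obtain ⟨α, β, hdet, hΛ, hΛ₂⟩ := exists_pair_eq_image_iota Φ H.hv₀ x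
  obtain ⟨lam, σ₁, hlam, hσ₁, hring₁, hl⟩ := exists_normalForm α β hdet
  obtain ⟨lamu, rfl⟩ := hlam
  refine ⟨lamu, (lamu⁻¹ : (Kq D ; q ; γ)ˣ) * α, (lamu⁻¹ : (Kq D ; q ; γ)ˣ) * β, σ₁, hσ₁, hring₁, ?_, ?_, ?_⟩
  · rw [latt_mul, hl, Set.image_image]
    have : (fun z => ((lamu⁻¹ : (Kq D ; q ; γ)ˣ) : Kq D ; q ; γ) * ((lamu : Kq D ; q ; γ) * z)) = id :=
      funext fun z => Units.inv_mul_cancel_left _ _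
    rw [this, Set.image_id]
  · rw [hΛ, ← latt_mul, Units.mul_inv_cancel_left, Units.mul_inv_cancel_left]
  · rw [hΛ₂, ← latt_mul, mul_smul_comm, Units.mul_inv_cancel_left, Units.mul_inv_cancel_left]

/-! #### Transport of the data along `c ∈ ℚ(γ)ˣ` -/

/-- If `x' O_(q) = c x O_(q)` with `c ∈ ℚ(γ)ˣ` then the data of `x'` are `κ` times the data of `x`
for a unit `κ ∈ K_q` (`Φ(c) = ψ(κ)`). [folklore] -/
theorem exists_unit_image_of_smul_eq {x x' c : Dˣ} (hc : (c : D) * γ = γ * c)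
    (h : x' • localAt q O = c • (x • localAt q O)) {L L₂ : Set (Kq D ; q ; γ)}
    (hΛ : colLatt (Φ (x : D)) = iota H.v₀ (Φ γ *ᵥ H.v₀) '' L)
    (hΛ₂ : colLatt (Φ (x : D) * diagQ q) = iota H.v₀ (Φ γ *ᵥ H.v₀) '' L₂) :
    ∃ κ : Kq D ; q ; γ, IsUnit κ ∧
      colLatt (Φ (x' : D)) = iota H.v₀ (Φ γ *ᵥ H.v₀) '' ((fun z => κ * z) '' L) ∧
        colLatt (Φ (x' : D) * diagQ q) = iota H.v₀ (Φ γ *ᵥ H.v₀) '' ((fun z => κ * z) '' L₂) := by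
  have hA := map_mul_self_eq Φ γ
  obtain ⟨r, s, hrs⟩ :=
    exists_rat_eq_of_mem_adjoin H.hD H.hγ ((mul_eq_mul_iff_mem_adjoin H.hD H.hγ).mp hc)
  have hc' : ((c⁻¹ : Dˣ) : D) * γ = γ * (c⁻¹ : Dˣ) := by
    rw [← Units.mul_left_inj c, mul_assoc, ← hc, ← mul_assoc, Units.inv_mul, one_mul,
      Units.inv_mul_cancel_right]
  obtain ⟨r', s', hrs'⟩ :=
    exists_rat_eq_of_mem_adjoin H.hD H.hγ ((mul_eq_mul_iff_mem_adjoin H.hD H.hγ).mp hc')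
  have hΦc : Φ (c : D) = QuadraticAlgebra.lift ⟨Φ γ, hA⟩ (⟨(r : ℚ_[q]), (s : ℚ_[q])⟩ : Kq D ; q ; γ) := by
    rw [hrs]; exact map_ratCoords Φ r s
  have hΦc' : Φ ((c⁻¹ : Dˣ) : D) =
      QuadraticAlgebra.lift ⟨Φ γ, hA⟩ (⟨(r' : ℚ_[q]), (s' : ℚ_[q])⟩ : Kq D ; q ; γ) := by
    rw [hrs']; exact map_ratCoords Φ r' s'
  have hκ : IsUnit (⟨(r : ℚ_[q]), (s : ℚ_[q])⟩ : Kq D ; q ; γ) := by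
    refine IsUnit.of_mul_eq_one (⟨(r' : ℚ_[q]), (s' : ℚ_[q])⟩ : Kq D ; q ; γ) (lift_injective Φ H.hv₀ ?_)
    rw [map_mul, map_one, ← hΦc, ← hΦc', ← map_mul, Units.mul_inv, map_one]
  obtain ⟨h1, h2⟩ := colLatt_eq_of_smul_localAt_eq_level Φ H.hO H.hO1 (x := x') (x' := c * x)
    (by rw [mul_smul]; exact h)
  refine ⟨_, hκ, ?_, ?_⟩
  · rw [h1, Units.val_mul, map_mul, colLatt_mul, hΛ, hΦc, image_mulVec_image_iota H.v₀ (Φ γ) hA]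
  · rw [h2, Units.val_mul, map_mul, mul_assoc, colLatt_mul, hΛ₂, hΦc,
      image_mulVec_image_iota H.v₀ (Φ γ) hA]

/-! #### The representatives -/

omit [IsQuaternionAlgebra ℚ D] in
/-- `det(σ_q + k, 1) ≠ 0`. [folklore] -/
theorem det_σq_add (k : ℚ_[q]) :
    (σq + k • 1).re * (1 : Kq D ; q ; γ).im - (1 : Kq D ; q ; γ).re * (σq + k • 1).im ≠ 0 := by
  rw [im_add_smul_one]
  change (σq + k • 1).re * 0 - 1 * (σq).im ≠ 0
  simpa using H.σq_im_ne

/-- **Representative of type I**: `b_k ∈ Dˣ` with `Λ = ι[1, σ_q]`, `Λ' = ι[σ_q + k, q]`. [folklore] -/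
def repI (H : LevelHyp Φ O γ B σ₀ r₀ m tB nB) (k : ℕ) : Dˣ :=
  (exists_units_pair_eq Φ H.hD
    (ofCols (iota H.v₀ (Φ γ *ᵥ H.v₀) (σq + (k : ℚ_[q]) • 1)) (iota H.v₀ (Φ γ *ᵥ H.v₀) 1))
    (isUnit_det_ofCols_iota Φ H.hv₀ (H.det_σq_add k))).choose

/-- The data of `b_k`. [folklore] -/
theorem repI_spec (k : ℕ) :
    colLatt (Φ (H.repI k : D)) = iota H.v₀ (Φ γ *ᵥ H.v₀) '' latt 1 σq ∧
      colLatt (Φ (H.repI k : D) * diagQ q) =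
        iota H.v₀ (Φ γ *ᵥ H.v₀) '' latt (σq + (k : ℚ_[q]) • 1) ((q : ℚ_[q]) • 1) := by
  have hk : ‖(k : ℚ_[q])‖ ≤ 1 := by simpa using Padic.norm_int_le_one (p := q) (k : ℤ)
  have h : colLatt (Φ (H.repI k : D)) =
      colLatt (ofCols (iota H.v₀ (Φ γ *ᵥ H.v₀) (σq + (k : ℚ_[q]) • 1)) (iota H.v₀ (Φ γ *ᵥ H.v₀) 1)) ∧
      colLatt (Φ (H.repI k : D) * diagQ q) =
        colLatt (ofCols (iota H.v₀ (Φ γ *ᵥ H.v₀) (σq + (k : ℚ_[q]) • 1)) (iota H.v₀ (Φ γ *ᵥ H.v₀) 1) *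
          diagQ q) :=
    (exists_units_pair_eq Φ H.hD
      (ofCols (iota H.v₀ (Φ γ *ᵥ H.v₀) (σq + (k : ℚ_[q]) • 1)) (iota H.v₀ (Φ γ *ᵥ H.v₀) 1))
      (isUnit_det_ofCols_iota Φ H.hv₀ (H.det_σq_add k))).choose_spec
  rwa [colLatt_ofCols_iota, colLatt_ofCols_iota_mul_diagQ, latt_swap, latt_one_add_smul_one _ hk] at h

/-- `mult[1, σ_q] ∩ mult[σ_q + k, q] = [1, σ_q + k]` when `q ∣ N(σ_q + k)`. [folklore] -/
theorem inter_I {k : ℕ} (hk : (q : ℤ) ∣ (k : ℤ) ^ 2 + tB * k + nB) :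
    mult 1 σq ∩ mult (σq + (k : ℚ_[q]) • 1) ((q : ℚ_[q]) • 1) = latt 1 (σq + (k : ℚ_[q]) • 1) := by
  have hk1 : ‖(k : ℚ_[q])‖ ≤ 1 := by simpa using Padic.norm_int_le_one (p := q) (k : ℤ)
  have hσ₃ : (σq + (k : ℚ_[q]) • 1).im ≠ 0 := by rw [im_add_smul_one]; exact H.σq_im_ne
  rw [← mult_congr (latt_one_add_smul_one σq hk1)]
  exact mult_one_inter_mult_smul_of_norm_lt hσ₃ (ring_add_smul_one H.σq_im_ne H.ring_σq hk1)
    ((H.norm_lt_one_iff_dvd k).mpr hk)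

/-- **`b_k O_(q)` has optimal order `B_(q)`** when `q ∣ N(σ_q + k)`. [folklore] -/
theorem repI_optimal {k : ℕ} (hk : (q : ℤ) ∣ (k : ℤ) ^ 2 + tB * k + nB) :
    optimalOrder (H.repI k • localAt q O) γ = localAt q B := by
  have hk1 : ‖(k : ℚ_[q])‖ ≤ 1 := by simpa using Padic.norm_int_le_one (p := q) (k : ℤ)
  have hσ₃ : (σq + (k : ℚ_[q]) • 1).im ≠ 0 := by rw [im_add_smul_one]; exact H.σq_im_ne
  obtain ⟨h1, h2⟩ := H.repI_spec k
  exact (H.optimalOrder_eq_iff_of_inter_eq _ hσ₃ h1 h2 (H.inter_I hk)).mpr (latt_one_add_smul_one σq hk1)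

/-- The local ideal `b_k O_(q)`. [folklore] -/
theorem repI_mem {k : ℕ} (hk : (q : ℤ) ∣ (k : ℤ) ^ 2 + tB * k + nB) :
    H.repI k • localAt q O ∈ localIdeals O γ B q :=
  ⟨⟨_, rfl⟩, H.repI_optimal hk⟩

/-- **Representative of type ⋆**: `b_⋆ ∈ Dˣ` with `Λ = ι[1, σ']`, `Λ' = ι[1, σ_q]`. [folklore] -/
def repStar (H : LevelHyp Φ O γ B σ₀ r₀ m tB nB) (k₀ : ℤ) : Dˣ :=
  (exists_units_pair_eq Φ H.hD (ofCols (iota H.v₀ (Φ γ *ᵥ H.v₀) 1) (iota H.v₀ (Φ γ *ᵥ H.v₀) σ'[k₀]))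
    (isUnit_det_ofCols_iota Φ H.hv₀ (det_one_left (H.σ'_im_ne k₀)))).choose

/-- The data of `b_⋆`. [folklore] -/
theorem repStar_spec (k₀ : ℤ) :
    colLatt (Φ (H.repStar k₀ : D)) = iota H.v₀ (Φ γ *ᵥ H.v₀) '' latt 1 σ'[k₀] ∧
      colLatt (Φ (H.repStar k₀ : D) * diagQ q) = iota H.v₀ (Φ γ *ᵥ H.v₀) '' latt 1 σq := by
  have h : colLatt (Φ (H.repStar k₀ : D)) =
      colLatt (ofCols (iota H.v₀ (Φ γ *ᵥ H.v₀) 1) (iota H.v₀ (Φ γ *ᵥ H.v₀) σ'[k₀])) ∧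
      colLatt (Φ (H.repStar k₀ : D) * diagQ q) =
        colLatt (ofCols (iota H.v₀ (Φ γ *ᵥ H.v₀) 1) (iota H.v₀ (Φ γ *ᵥ H.v₀) σ'[k₀]) * diagQ q) :=
    (exists_units_pair_eq Φ H.hD
      (ofCols (iota H.v₀ (Φ γ *ᵥ H.v₀) 1) (iota H.v₀ (Φ γ *ᵥ H.v₀) σ'[k₀]))
      (isUnit_det_ofCols_iota Φ H.hv₀ (det_one_left (H.σ'_im_ne k₀)))).choose_spec
  rwa [colLatt_ofCols_iota, colLatt_ofCols_iota_mul_diagQ, latt_one_smul_σ'] at h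

omit [IsQuaternionAlgebra ℚ D] in
/-- `(qσ').im ≠ 0`. [folklore] -/
theorem smul_σ'_im_ne (k₀ : ℤ) : ((q : ℚ_[q]) • σ'[k₀]).im ≠ 0 := by
  rw [im_smul']
  exact mul_ne_zero (Nat.cast_ne_zero.mpr hq.out.ne_zero) (H.σ'_im_ne k₀)

/-- `mult[1, σ'] ∩ mult[1, σ_q] = [1, qσ']` when `σ'` is a ring generator. [folklore] -/
theorem inter_star {k₀ : ℤ} (h1 : (q : ℤ) ∣ tB + 2 * k₀) (h2 : (q : ℤ) ^ 2 ∣ k₀ ^ 2 + tB * k₀ + nB) :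
    mult 1 σ'[k₀] ∩ mult 1 σq = latt 1 ((q : ℚ_[q]) • σ'[k₀]) := by
  rw [← mult_congr (latt_one_smul_σ' k₀)]
  exact mult_one_inter_mult_one_smul (H.σ'_im_ne k₀) (H.ring_σ' h1 h2)

/-- **`b_⋆ O_(q)` has optimal order `B_(q)`** when `B_q` is not maximal. [folklore] -/
theorem repStar_optimal {k₀ : ℤ} (h1 : (q : ℤ) ∣ tB + 2 * k₀) (h2 : (q : ℤ) ^ 2 ∣ k₀ ^ 2 + tB * k₀ + nB) :
    optimalOrder (H.repStar k₀ • localAt q O) γ = localAt q B := by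
  obtain ⟨hs1, hs2⟩ := H.repStar_spec k₀
  exact (H.optimalOrder_eq_iff_of_inter_eq _ (H.smul_σ'_im_ne k₀) hs1 hs2 (H.inter_star h1 h2)).mpr
    (latt_one_smul_σ' k₀)

/-- The local ideal `b_⋆ O_(q)`. [folklore] -/
theorem repStar_mem {k₀ : ℤ} (h1 : (q : ℤ) ∣ tB + 2 * k₀) (h2 : (q : ℤ) ^ 2 ∣ k₀ ^ 2 + tB * k₀ + nB) :
    H.repStar k₀ • localAt q O ∈ localIdeals O γ B q :=
  ⟨⟨_, rfl⟩, H.repStar_optimal h1 h2⟩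

/-! #### Every class is represented -/

/-- A local ideal whose data are `μ[1, σ_q], μ[σ_q + k, q]` is in the class of `b_k`. [folklore] -/
theorem mk_eq_mk_repI {x : Dˣ} (hx : x • localAt q O ∈ localIdeals O γ B q) {k : ℕ}
    (hk : (q : ℤ) ∣ (k : ℤ) ^ 2 + tB * k + nB) {μ : Kq D ; q ; γ} (hμ : IsUnit μ)
    (hΛ : colLatt (Φ (x : D)) = iota H.v₀ (Φ γ *ᵥ H.v₀) '' ((fun z => μ * z) '' latt 1 σq))
    (hΛ₂ : colLatt (Φ (x : D) * diagQ q) =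
      iota H.v₀ (Φ γ *ᵥ H.v₀) '' ((fun z => μ * z) '' latt (σq + (k : ℚ_[q]) • 1) ((q : ℚ_[q]) • 1))) :
    (LocalClass.mk ⟨x • localAt q O, hx⟩ : LocalClass O γ B q) =
      LocalClass.mk ⟨H.repI k • localAt q O, H.repI_mem hk⟩ := by
  rw [eq_comm, LocalClass.mk_eq_mk_iff]
  obtain ⟨hs1, hs2⟩ := H.repI_spec k
  exact exists_eq_smul_of_pair_eq Φ H.hD H.hO H.hv₀ (det_one_left H.σq_im_ne)
    (det_add_smul_one_smul_one H.σq_im_ne _) hμ hs1 hs2 hΛ hΛ₂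

/-- A local ideal whose data are `μ[1, σ₁], μ[1, σ_q]` with `[1, qσ₁] = [1, σ_q]` is in the class
of `b_⋆`. [folklore] -/
theorem mk_eq_mk_repStar {x : Dˣ} (hx : x • localAt q O ∈ localIdeals O γ B q) {k₀ : ℤ}
    (h1 : (q : ℤ) ∣ tB + 2 * k₀) (h2 : (q : ℤ) ^ 2 ∣ k₀ ^ 2 + tB * k₀ + nB)
    {μ σ₁ : Kq D ; q ; γ} (hμ : IsUnit μ) (hσ₁ : σ₁.im ≠ 0) (hring₁ : σ₁ * σ₁ ∈ latt 1 σ₁)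
    (hq1 : latt 1 ((q : ℚ_[q]) • σ₁) = latt 1 σq)
    (hΛ : colLatt (Φ (x : D)) = iota H.v₀ (Φ γ *ᵥ H.v₀) '' ((fun z => μ * z) '' latt 1 σ₁))
    (hΛ₂ : colLatt (Φ (x : D) * diagQ q) = iota H.v₀ (Φ γ *ᵥ H.v₀) '' ((fun z => μ * z) '' latt 1 σq)) :
    (LocalClass.mk ⟨x • localAt q O, hx⟩ : LocalClass O γ B q) =
      LocalClass.mk ⟨H.repStar k₀ • localAt q O, H.repStar_mem h1 h2⟩ := by
  have e : latt 1 σ₁ = latt 1 σ'[k₀] :=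
    latt_one_eq_of_latt_one_smul_eq hσ₁ (H.σ'_im_ne k₀) hring₁ (H.ring_σ' h1 h2)
      (by rw [hq1, latt_one_smul_σ'])
  rw [e] at hΛ
  rw [eq_comm, LocalClass.mk_eq_mk_iff]
  obtain ⟨hs1, hs2⟩ := H.repStar_spec k₀
  exact exists_eq_smul_of_pair_eq Φ H.hD H.hO H.hv₀ (det_one_left (H.σ'_im_ne k₀))
    (det_one_left H.σq_im_ne) hμ hs1 hs2 hΛ hΛ₂

/-- **Surjectivity**: every local ideal with optimal order `B_(q)` is in the class of some `b_k`
(`0 ≤ k < q`, `q ∣ N(σ_q + k)`) or — and then `B_q` is not maximal — of `b_⋆`. [folklore] -/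
theorem mk_eq_cases {x : Dˣ} (hx : x • localAt q O ∈ localIdeals O γ B q) :
    (∃ k : ℕ, ∃ hk : (q : ℤ) ∣ (k : ℤ) ^ 2 + tB * k + nB, k < q ∧
      (LocalClass.mk ⟨x • localAt q O, hx⟩ : LocalClass O γ B q) =
        LocalClass.mk ⟨H.repI k • localAt q O, H.repI_mem hk⟩) ∨
    ((∃ k₁ : ℤ, (q : ℤ) ∣ tB + 2 * k₁ ∧ (q : ℤ) ^ 2 ∣ k₁ ^ 2 + tB * k₁ + nB) ∧
      ∀ k₀ : ℤ, ∀ h1 : (q : ℤ) ∣ tB + 2 * k₀, ∀ h2 : (q : ℤ) ^ 2 ∣ k₀ ^ 2 + tB * k₀ + nB,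
        (LocalClass.mk ⟨x • localAt q O, hx⟩ : LocalClass O γ B q) =
          LocalClass.mk ⟨H.repStar k₀ • localAt q O, H.repStar_mem h1 h2⟩) := by
  have hopt : optimalOrder (x • localAt q O) γ = localAt q B := hx.2
  obtain ⟨lam, α', β', σ₁, hσ₁, hring₁, hl, hΛ, hΛ₂⟩ := H.exists_unit_pair x
  by_cases hq1 : latt 1 σ₁ = latt 1 σq
  · -- the lattice `Λ_x` is `λ[1, σ_q]`: type I
    left
    rw [hl, hq1] at hΛ
    rcases latt_smul_eq_cases H.σq_im_ne (hl.trans hq1) with h2 | ⟨k', hk', h2⟩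
    · exfalso
      rw [h2] at hΛ₂
      have hτ : ((q : ℚ_[q]) • σq).im ≠ 0 := by
        rw [im_smul']; exact mul_ne_zero (Nat.cast_ne_zero.mpr hq.out.ne_zero) H.σq_im_ne
      have := (H.optimalOrder_eq_iff_of_inter_eq' x hτ hΛ hΛ₂
        (mult_one_inter_mult_one_smul H.σq_im_ne H.ring_σq)).mp hopt
      exact latt_one_smul_ne H.σq_im_ne this
    · rw [h2] at hΛ₂
      have hσ₃ : (σq + k' • 1).im ≠ 0 := by rw [im_add_smul_one]; exact H.σq_im_ne
      have hring₃ := ring_add_smul_one H.σq_im_ne H.ring_σq hk'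
      have hN₃ : ‖(σq + k' • 1).norm‖ < 1 := by
        refine lt_of_le_of_ne (norm_norm_le_one_of_ring hσ₃ hring₃) fun hN => ?_
        have hint : mult 1 σq ∩ mult (σq + k' • 1) ((q : ℚ_[q]) • 1) = latt 1 ((q : ℚ_[q]) • (σq + k' • 1)) := by
          rw [← mult_congr (latt_one_add_smul_one σq hk')]
          exact mult_one_inter_mult_smul_of_norm_eq_one hσ₃ hring₃ hN
        have hτ : ((q : ℚ_[q]) • (σq + k' • 1)).im ≠ 0 := by
          rw [im_smul']; exact mul_ne_zero (Nat.cast_ne_zero.mpr hq.out.ne_zero) hσ₃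
        have := (H.optimalOrder_eq_iff_of_inter_eq' x hτ hΛ hΛ₂ hint).mp hopt
        rw [← latt_one_add_smul_one σq hk'] at this
        exact latt_one_smul_ne hσ₃ this
      obtain ⟨k, hkq, hkk⟩ := exists_nat_lt_norm_sub_lt_one hk'
      have hk1 : ‖(k : ℚ_[q])‖ ≤ 1 := by simpa using Padic.norm_int_le_one (p := q) (k : ℤ)
      have hNk : ‖(σq + (k : ℚ_[q]) • 1).norm‖ < 1 := H.norm_norm_add_lt_one_of_sub hk' hk1 hN₃ hkk
      have hk : (q : ℤ) ∣ (k : ℤ) ^ 2 + tB * k + nB := (H.norm_lt_one_iff_dvd k).mp hNk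
      refine ⟨k, hk, hkq, H.mk_eq_mk_repI hx hk lam.isUnit hΛ ?_⟩
      rw [hΛ₂, (latt_add_smul_one_smul_eq_iff H.σq_im_ne k' (k : ℚ_[q])).mpr hkk]
  · right
    rw [hl] at hΛ
    rcases latt_smul_eq_cases hσ₁ hl with h2 | ⟨k, hk, h2⟩
    · -- `Λ'_x = λ[1, qσ₁]`: type ⋆
      rw [h2] at hΛ₂
      have hτ : ((q : ℚ_[q]) • σ₁).im ≠ 0 := by
        rw [im_smul']; exact mul_ne_zero (Nat.cast_ne_zero.mpr hq.out.ne_zero) hσ₁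
      have hq2 : latt 1 ((q : ℚ_[q]) • σ₁) = latt 1 σq :=
        (H.optimalOrder_eq_iff_of_inter_eq' x hτ hΛ hΛ₂ (mult_one_inter_mult_one_smul hσ₁ hring₁)).mp hopt
      rw [hq2] at hΛ₂
      exact ⟨H.exists_int_of_latt_one_smul_eq hσ₁ hring₁ hq2, fun k₀ h1' h2' =>
        H.mk_eq_mk_repStar hx h1' h2' lam.isUnit hσ₁ hring₁ hq2 hΛ hΛ₂⟩
    · -- `Λ'_x = λ[σ₂, q]`, `σ₂ = σ₁ + k`
      rw [h2] at hΛ₂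
      have hσ₂ : (σ₁ + k • 1).im ≠ 0 := by rw [im_add_smul_one]; exact hσ₁
      have hring₂ := ring_add_smul_one hσ₁ hring₁ hk
      have h21 : latt 1 (σ₁ + k • 1) = latt 1 σ₁ := latt_one_add_smul_one σ₁ hk
      rw [← h21] at hΛ
      rcases (norm_norm_le_one_of_ring hσ₂ hring₂).lt_or_eq with hN | hN
      · -- `‖N σ₂‖ < 1` would force `[1, σ₁] = [1, σ_q]`
        exfalso
        have hint : mult 1 (σ₁ + k • 1) ∩ mult (σ₁ + k • 1) ((q : ℚ_[q]) • 1) = latt 1 (σ₁ + k • 1) :=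
          mult_one_inter_mult_smul_of_norm_lt hσ₂ hring₂ hN
        have := (H.optimalOrder_eq_iff_of_inter_eq' x hσ₂ hΛ hΛ₂ hint).mp hopt
        exact hq1 (h21.symm.trans this)
      · -- `‖N σ₂‖ = 1`: type ⋆ with `μ = λσ₂`
        have hτ : ((q : ℚ_[q]) • (σ₁ + k • 1)).im ≠ 0 := by
          rw [im_smul']; exact mul_ne_zero (Nat.cast_ne_zero.mpr hq.out.ne_zero) hσ₂
        have hq2 : latt 1 ((q : ℚ_[q]) • (σ₁ + k • 1)) = latt 1 σq :=
          (H.optimalOrder_eq_iff_of_inter_eq' x hτ hΛ hΛ₂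
            (mult_one_inter_mult_smul_of_norm_eq_one hσ₂ hring₂ hN)).mp hopt
        obtain ⟨e1, e2⟩ := image_mul_latt_one_smul hσ₂ hring₂ rfl hN
        rw [hq2] at e2
        have hμ : IsUnit ((lam : Kq D ; q ; γ) * (σ₁ + k • 1)) :=
          lam.isUnit.mul (isUnit_iff_norm_ne_zero.mpr fun h0 => by
            rw [h0, norm_zero] at hN; exact zero_ne_one hN)
        refine ⟨H.exists_int_of_latt_one_smul_eq hσ₂ hring₂ hq2, fun k₀ h1' h2' =>
          H.mk_eq_mk_repStar hx h1' h2' hμ hσ₂ hring₂ hq2 ?_ ?_⟩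
        · rw [hΛ, image_mul_mul, e1]
        · rw [hΛ₂, image_mul_mul, e2]

/-! #### Distinct representatives are inequivalent -/

/-- `b_k ∼ b_{k'}` forces `k = k'` (`0 ≤ k, k' < q`). [folklore] -/
theorem eq_of_mk_repI_eq {k k' : ℕ} (hk : (q : ℤ) ∣ (k : ℤ) ^ 2 + tB * k + nB)
    (hk' : (q : ℤ) ∣ (k' : ℤ) ^ 2 + tB * k' + nB) (hkq : k < q) (hkq' : k' < q)
    (h : (LocalClass.mk ⟨H.repI k • localAt q O, H.repI_mem hk⟩ : LocalClass O γ B q) =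
      LocalClass.mk ⟨H.repI k' • localAt q O, H.repI_mem hk'⟩) : k = k' := by
  rw [LocalClass.mk_eq_mk_iff] at h
  obtain ⟨c, hc, hcL⟩ := h
  obtain ⟨hs1, hs2⟩ := H.repI_spec k
  obtain ⟨hs1', hs2'⟩ := H.repI_spec k'
  obtain ⟨κ, -, e1, e2⟩ := H.exists_unit_image_of_smul_eq hc hcL hs1 hs2
  have hinj := Set.image_injective.mpr (iota_injective H.v₀ (Φ γ *ᵥ H.v₀) H.hv₀
    (a := -((reducedNorm ℚ D γ : ℚ) : ℚ_[q])) (b := ((reducedTrace ℚ D γ : ℚ) : ℚ_[q])))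
  rw [hs1'] at e1
  rw [hs2'] at e2
  have e1 := hinj e1
  have e2 := hinj e2
  -- `κ, κ⁻¹ ∈ [1, σ_q] = mult[1, σ_q] ∩ mult[σ_q + k, q]`
  have hκmem : κ ∈ latt 1 σq := by
    rw [e1]; exact ⟨1, left_mem_latt _ _, mul_one κ⟩
  obtain ⟨w, hw, hκw⟩ : ∃ w ∈ latt 1 σq, κ * w = 1 := by
    have : (1 : Kq D ; q ; γ) ∈ (fun z => κ * z) '' latt 1 σq := by rw [← e1]; exact left_mem_latt _ _
    obtain ⟨w, hw, hκw⟩ := this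
    exact ⟨w, hw, hκw⟩
  have hk1 : ‖(k : ℚ_[q])‖ ≤ 1 := by simpa using Padic.norm_int_le_one (p := q) (k : ℤ)
  have hint := H.inter_I hk
  rw [latt_one_add_smul_one σq hk1] at hint
  have hκm : κ ∈ mult (σq + (k : ℚ_[q]) • 1) ((q : ℚ_[q]) • 1) := by
    rw [← hint] at hκmem; exact hκmem.2
  have hwm : w ∈ mult (σq + (k : ℚ_[q]) • 1) ((q : ℚ_[q]) • 1) := by
    rw [← hint] at hw; exact hw.2
  rw [image_mul_latt_eq_of_mem_mult hκm hwm hκw] at e2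
  have hlt := (latt_add_smul_one_smul_eq_iff H.σq_im_ne (k' : ℚ_[q]) (k : ℚ_[q])).mp e2
  have hdvd : (q : ℤ) ∣ (k' : ℤ) - k := by
    rw [← Padic.norm_intCast_lt_one_iff]; push_cast; exact hlt
  exact (Nat.modEq_iff_dvd.mpr hdvd).eq_of_lt_of_lt hkq hkq'

/-- `b_k ≁ b_⋆`. [folklore] -/
theorem mk_repI_ne_mk_repStar {k : ℕ} (hk : (q : ℤ) ∣ (k : ℤ) ^ 2 + tB * k + nB) {k₀ : ℤ}
    (h1 : (q : ℤ) ∣ tB + 2 * k₀) (h2 : (q : ℤ) ^ 2 ∣ k₀ ^ 2 + tB * k₀ + nB) :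
    (LocalClass.mk ⟨H.repI k • localAt q O, H.repI_mem hk⟩ : LocalClass O γ B q) ≠
      LocalClass.mk ⟨H.repStar k₀ • localAt q O, H.repStar_mem h1 h2⟩ := by
  intro h
  rw [LocalClass.mk_eq_mk_iff] at h
  obtain ⟨c, hc, hcL⟩ := h
  obtain ⟨hs1, hs2⟩ := H.repI_spec k
  obtain ⟨hs1', -⟩ := H.repStar_spec k₀
  obtain ⟨κ, hκ, e1, -⟩ := H.exists_unit_image_of_smul_eq hc hcL hs1 hs2
  have hinj := Set.image_injective.mpr (iota_injective H.v₀ (Φ γ *ᵥ H.v₀) H.hv₀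
    (a := -((reducedNorm ℚ D γ : ℚ) : ℚ_[q])) (b := ((reducedTrace ℚ D γ : ℚ) : ℚ_[q])))
  rw [hs1'] at e1
  have e := mult_eq_of_latt_eq_image hκ (hinj e1)
  rw [mult_one_eq_latt (H.ring_σ' h1 h2), mult_one_eq_latt H.ring_σq, ← latt_one_smul_σ' k₀] at e
  exact latt_one_smul_ne (H.σ'_im_ne k₀) e.symm

/-! #### The count -/

/-- **The local embedding number at a prime `q` exactly dividing the level**
(`O_(q)` an Eichler order of level `q`): for an order `B ∋ γ` with `B_q = ℤ_q[σ_q]`,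
`σ_q² - t_B σ_q + n_B = 0`,
`m_q(B) = #{k mod q : q ∣ k² + t_B k + n_B} + [B_q is not a maximal order]`,
i.e. `m_q = 1 + (d_B / q)` for `B_q` maximal and `m_q = 2` otherwise (the case `q ∥ N` of
Eichler's table of local embedding numbers). [cite: VignerasLNM800, Ch. II §3; Ch. III §5 Thm. 5.11 and Exercice 5.2] -/
theorem localEmbeddingNumber_eq
    [Decidable (∃ k : ℤ, (q : ℤ) ∣ tB + 2 * k ∧ (q : ℤ) ^ 2 ∣ k ^ 2 + tB * k + nB)] :
    localEmbeddingNumber O γ B q =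
      ((Finset.range q).filter (fun k : ℕ => (q : ℤ) ∣ (k : ℤ) ^ 2 + tB * k + nB)).card +
        (if ∃ k : ℤ, (q : ℤ) ∣ tB + 2 * k ∧ (q : ℤ) ^ 2 ∣ k ^ 2 + tB * k + nB then 1 else 0) := by
  classical
  set S := (Finset.range q).filter (fun k : ℕ => (q : ℤ) ∣ (k : ℤ) ^ 2 + tB * k + nB) with hS
  have hmemS : ∀ {k : ℕ}, k ∈ S ↔ k < q ∧ (q : ℤ) ∣ (k : ℤ) ^ 2 + tB * k + nB := by
    intro k; rw [hS, Finset.mem_filter, Finset.mem_range]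
  let f : {k // k ∈ S} → LocalClass O γ B q := fun k =>
    LocalClass.mk ⟨H.repI k • localAt q O, H.repI_mem (hmemS.mp k.2).2⟩
  let g : PLift (∃ k : ℤ, (q : ℤ) ∣ tB + 2 * k ∧ (q : ℤ) ^ 2 ∣ k ^ 2 + tB * k + nB) → LocalClass O γ B q :=
    fun h =>
    LocalClass.mk ⟨H.repStar h.down.choose • localAt q O,
      H.repStar_mem h.down.choose_spec.1 h.down.choose_spec.2⟩
  have hf : Function.Injective f := by
    intro k k' h
    exact Subtype.ext (H.eq_of_mk_repI_eq (hmemS.mp k.2).2 (hmemS.mp k'.2).2 (hmemS.mp k.2).1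
      (hmemS.mp k'.2).1 h)
  have hg : Function.Injective g := fun a b _ => Subsingleton.elim a b
  have hfg : ∀ a b, f a ≠ g b := fun a b =>
    H.mk_repI_ne_mk_repStar (hmemS.mp a.2).2 b.down.choose_spec.1 b.down.choose_spec.2
  have hsurj : Function.Surjective (Sum.elim f g) := by
    intro C
    obtain ⟨⟨L, ⟨x, rfl⟩, hopt⟩, rfl⟩ := LocalClass.mk_surjective C
    rcases H.mk_eq_cases ⟨⟨x, rfl⟩, hopt⟩ with ⟨k, hk, hkq, e⟩ | ⟨hnm, e⟩
    · exact ⟨Sum.inl ⟨k, hmemS.mpr ⟨hkq, hk⟩⟩, e.symm⟩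
    · exact ⟨Sum.inr ⟨hnm⟩, (e _ hnm.choose_spec.1 hnm.choose_spec.2).symm⟩
  have hbij : Function.Bijective (Sum.elim f g) := ⟨hf.sumElim hg hfg, hsurj⟩
  rw [localEmbeddingNumber, ← Nat.card_congr (Equiv.ofBijective _ hbij), Nat.card_sum,
    Nat.card_eq_fintype_card, Fintype.card_coe]
  congr 1
  by_cases h : ∃ k : ℤ, (q : ℤ) ∣ tB + 2 * k ∧ (q : ℤ) ^ 2 ∣ k ^ 2 + tB * k + nB
  · rw [if_pos h]
    haveI : Nonempty (PLift (∃ k : ℤ, (q : ℤ) ∣ tB + 2 * k ∧ (q : ℤ) ^ 2 ∣ k ^ 2 + tB * k + nB)) := ⟨⟨h⟩⟩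
    exact Nat.card_unique
  · rw [if_neg h]
    haveI : IsEmpty (PLift (∃ k : ℤ, (q : ℤ) ∣ tB + 2 * k ∧ (q : ℤ) ^ 2 ∣ k ^ 2 + tB * k + nB)) :=
      ⟨fun x => h x.down⟩
    exact Nat.card_of_isEmpty

end LevelHyp

end LevelCount

end Brandt

end Literature.NumberTheory.Automorphic

end
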